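import Summits.ABC.ABC.Theses.TwistAmplification
import Literature.NumberTheory.DiophantineGeometry.AbcExceptionalSetBounds
import Literature.NumberTheory.DiophantineGeometry.AbcImpliesHall

/-!
# Disproof of `MazurKaneLaw` (crux stmt-ABC-2757, route-ABC-TwistAmplification) — findings

WORK FILE of the standing crux disprover (refuter-cdisprove-stmt-ABC-2757-0). `lean check` rc 0,
0 sorry, axioms ⊆ {propext, Classical.choice, Quot.sound}. Prose only in docstrings. VERDICT SO FAR:
the crux (upper half of Mazur's question / Kane 2011 Conj. 1, joint-radical form, `1 < s < 2`) is a
believed open conjecture; it RESISTS every cheap attack (all explicit families sit on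
`N^{s-1} · (log N)^{O(1)}`; the heuristic is self-consistent under polynomial substitution by
Mason–Stothers). What IS refutable are its natural strengthenings, below. The gate refuses
refuter-landed support files under `Theorems/` (code `theorems.refuter`: only `¬ Theses-decl`
theorems), so these lemmas travel as item evidence (this file + `EpsNeeded.lean`,
`NegativeLoadBearing.lean`, import-ready copies) for a prover to land.

* §0 Normal forms: `mkSet`, `mkCount` (= `T_s(N)`), `LawAt s e`; `mazurKaneLaw_iff` (defeq);
  sandwich with the Literature counting function `abcExponentCount` (strict `<`, BLT's `N_λ`):
  `mazurKaneLaw_iff_abcExponentCount` — the crux is literally "N_s(X) ≪_{s,ε} X^{s-1+ε}, 1<s<2".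
* §1 LOAD-BEARING ANALYSIS:
  - `lawAt_iff_forall_nat` : the side condition `2 ≤ N` is decoration (`T_s(0)=T_s(1)=0`);
  - `lawAt_of_three_le` : `s < 2` is not where falsity hides (for `s ≥ 3` the bound is trivial;
    `2 ≤ s < 3` is Kane 2011 Thm 2, not reproduced);
  - `mazurKaneLaw_false_without_one_lt` : dropping `1 < s` is fatal (s = 9/10, ε = 1/20, the single
    hit (1,8,9) against a decaying bound); the endpoint `s = 1` itself (`#hits ≤ C_ε N^ε`) is OPEN;
  - `mazurKaneLaw_false_without_eps` / `not_lawAt_one_add_inv_zero` : dropping `0 < ε` is FATAL at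
    every `s = 1 + 1/n` (n ≥ 2): the power family `(xⁿ, rⁿ - xⁿ, rⁿ)`, `r = 2^k 3^l ∈ (M/2, M]`,
    `x ≡ 1 (6)`, `6x ≤ r`, gives `T_{1+1/n}(Mⁿ) ≥ K · M/128` at `M = 128 · 4^K`, i.e.
    `T_{1+1/n}(N) ≫ N^{1/n} log N`; so any proof must lose at least a logarithm;
  - `abcExponentCount_one_add_inv_not_bigO` / `…three_halves_not_bigO_sqrt` : the same in BLT's
    notation — MAZUR'S QUESTION IN ITS LITERAL ε-FREE FORM ("exact order X^{λ-1}", BLT p. 3) HAS A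
    NEGATIVE ANSWER at every `λ = 1 + 1/n` (upper side off by ≥ log X); Kane's `X^{±ε}` form (= the
    crux) is the right statement;
  - `not_lawAt_of_exponent_le_inv` : no exponent `≤ 1/n` works for `T_s`, `s ≥ 1 + 1/n`;
  - `abcExponentCount_not_bigO` / `not_lawAt_zero` / `mazurKaneLawSharp_false_everywhere` : THE
    FULL-INTERVAL STATEMENT — for EVERY real `s ∈ (1,2)`, `N_s(X) ≠ O(X^{s-1})` and the sharp law
    fails, via the smooth-height family `(1, c-1, c)`, `c = 2^k 3^l m`, `m ≡ 1 (6)`,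
    `m ≤ ⌊((R/2)^{s-1}/6)^{1/(2-s)}⌋` (real-exponent bookkeeping `smooth_count_ge`, `height_rpow_le`);
  - `mazurKaneLaw_false_without_coprime` : weakening `IsABCTriple` to `0 < a ∧ 0 < b ∧ a + b = c`
    (no `gcd(a,b) = 1`) is FATAL (s = 3/2, ε = 1/8: the dyadic family `(i·2^{2ν+1}, c - a, 2^{8ν})`
    gives `≍ N^{3/4}` triples); positivity of `a, b` is immaterial given coprimality (only `(0,1,1)`).
* §2 TIGHTNESS: `tight_at_one_add_inv` : `T_{1+1/n}(Rⁿ) ≥ R - 1` from `(1, rⁿ - 1, rⁿ)` (the cheap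
  one-parameter family; exponent `s - 1` attained).
* §3 STRENGTH GAUGE: `abcHitCount_le_of_mazurKaneLaw` : the crux implies `N(X) ≪_δ X^δ` for the
  abc-hit count for EVERY δ > 0 (record: X^{0.65}, BLT 2026; trivial 2/3 in tree; Dahmen's lower
  bound exp((log X)^{1/2-ε}) is consistent) — near `s → 1⁺` the crux IS "abc hits are X^{o(1)}".
* §4 WHY IT RESISTS (docstring at the end) + census job ids.
-/

noncomputable section

set_option linter.dupNamespace false

namespace Summit.ABC.ABC.Cruxes.MazurKaneLaw.Disproof

open Literature.NumberTheory.DiophantineGeometry UniqueFactorizationMonoid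
open Summit.ABC.ABC.Theses.TwistAmplification (MazurKaneLaw)

/-! ## §0 Normal forms -/

/-- The counting set of the crux at exponent `s` and height `N`: ordered abc triples `(a,b,c)`,
`c ≤ N`, `rad(abc) ≤ c^s` (non-strict). [folklore] -/
def mkSet (s : ℝ) (N : ℕ) : Set (ℕ × ℕ × ℕ) :=
  {t | IsABCTriple t.1 t.2.1 t.2.2 ∧ t.2.2 ≤ N ∧ ((rad t.1 t.2.1 t.2.2 : ℕ) : ℝ) ≤ (t.2.2 : ℝ) ^ s}

/-- `T_s(N)`, the count of the crux. [folklore] -/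
def mkCount (s : ℝ) (N : ℕ) : ℕ := (mkSet s N).ncard

/-- The bound of the crux at the exponent pair `(s, e)`: `∃ C, ∀ N ≥ 2, T_s(N) ≤ C · N^(s-1+e)`.
[folklore] -/
def LawAt (s e : ℝ) : Prop :=
  ∃ C : ℝ, ∀ N : ℕ, 2 ≤ N → (mkCount s N : ℝ) ≤ C * (N : ℝ) ^ (s - 1 + e)

/-- The crux, definitionally. [folklore] -/
theorem mazurKaneLaw_iff :
    MazurKaneLaw ↔ ∀ s : ℝ, 1 < s → s < 2 → ∀ ε : ℝ, 0 < ε → LawAt s ε :=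
  Iff.rfl

/-- The counting set is finite (it lies in `[0,N]³`). [folklore] -/
theorem mkSet_finite (s : ℝ) (N : ℕ) : (mkSet s N).Finite := by
  refine ((Set.finite_Iic N).prod ((Set.finite_Iic N).prod (Set.finite_Iic N))).subset ?_
  rintro ⟨a, b, c⟩ ⟨⟨ha, hb, habc, -⟩, hcX, -⟩
  simp only [Set.mem_prod, Set.mem_Iic] at *
  omega

/-- In an abc triple `c ≥ 2`. [folklore] -/
theorem two_le_of_isABCTriple {a b c : ℕ} (h : IsABCTriple a b c) : 2 ≤ c := by
  obtain ⟨ha, hb, habc, -⟩ := h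
  omega

/-- `T_s(N) = 0` for `N ≤ 1`. [folklore] -/
theorem mkCount_eq_zero_of_le_one {s : ℝ} {N : ℕ} (hN : N ≤ 1) : mkCount s N = 0 := by
  rw [mkCount, Set.ncard_eq_zero (mkSet_finite s N), Set.eq_empty_iff_forall_notMem]
  rintro ⟨a, b, c⟩ ⟨ht, hcN, -⟩
  have := two_le_of_isABCTriple ht
  simp only at hcN this
  omega

/-- Literature's strict count is below the crux's count. [folklore] -/
theorem abcExponentCount_le_mkCount (s : ℝ) (N : ℕ) : abcExponentCount s N ≤ mkCount s N := by
  rw [abcExponentCount, mkCount]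
  refine Set.ncard_le_ncard ?_ (mkSet_finite s N)
  rintro t ⟨ht, hcN, hlt⟩
  exact ⟨ht, hcN, hlt.le⟩

/-- The crux's count at `s` is below Literature's strict count at any `s' > s` (as `c ≥ 2`).
[folklore] -/
theorem mkCount_le_abcExponentCount {s s' : ℝ} (h : s < s') (N : ℕ) :
    mkCount s N ≤ abcExponentCount s' N := by
  rw [abcExponentCount, mkCount]
  refine Set.ncard_le_ncard ?_ (abcExponentCount_finite s' N)
  rintro ⟨a, b, c⟩ ⟨ht, hcN, hle⟩
  refine ⟨ht, hcN, hle.trans_lt ?_⟩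
  have hc : (1 : ℝ) < c := by exact_mod_cast two_le_of_isABCTriple ht
  exact Real.rpow_lt_rpow_of_exponent_lt hc h

/-- NORMAL FORM: the crux is the statement `N_s(X) ≪_{s,ε} X^{s-1+ε}` (`1 < s < 2`) about the
Literature counting function `abcExponentCount` (strict inequality `rad(abc) < c^s`, Bernert–
Browning–Lichtman–Teräväinen's `N_λ(X)`); the `≤ / <` difference is absorbed by `ε`. [folklore] -/
theorem mazurKaneLaw_iff_abcExponentCount :
    MazurKaneLaw ↔ ∀ s : ℝ, 1 < s → s < 2 → ∀ ε : ℝ, 0 < ε → ∃ C : ℝ, ∀ N : ℕ, 2 ≤ N →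
      (abcExponentCount s N : ℝ) ≤ C * (N : ℝ) ^ (s - 1 + ε) := by
  rw [mazurKaneLaw_iff]
  constructor
  · intro h s hs1 hs2 ε hε
    obtain ⟨C, hC⟩ := h s hs1 hs2 ε hε
    refine ⟨C, fun N hN => le_trans ?_ (hC N hN)⟩
    exact_mod_cast abcExponentCount_le_mkCount s N
  · intro h s hs1 hs2 ε hε
    set δ : ℝ := min (ε / 2) ((2 - s) / 2) with hδ
    have hδ0 : 0 < δ := lt_min (by linarith) (by linarith)
    have hδ1 : δ ≤ ε / 2 := min_le_left _ _
    have hδ2 : δ ≤ (2 - s) / 2 := min_le_right _ _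
    obtain ⟨C, hC⟩ := h (s + δ) (by linarith) (by linarith) (ε / 2) (by linarith)
    refine ⟨max C 0, fun N hN => ?_⟩
    have hN1 : (1 : ℝ) ≤ N := by exact_mod_cast (show 1 ≤ N by omega)
    calc (mkCount s N : ℝ) ≤ abcExponentCount (s + δ) N := by
          exact_mod_cast mkCount_le_abcExponentCount (by linarith) N
      _ ≤ C * (N : ℝ) ^ (s + δ - 1 + ε / 2) := hC N hN
      _ ≤ max C 0 * (N : ℝ) ^ (s + δ - 1 + ε / 2) :=
          mul_le_mul_of_nonneg_right (le_max_left _ _) (Real.rpow_nonneg (by positivity) _)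
      _ ≤ max C 0 * (N : ℝ) ^ (s - 1 + ε) :=
          mul_le_mul_of_nonneg_left (Real.rpow_le_rpow_of_exponent_le hN1 (by linarith))
            (le_max_right _ _)

/-! ## §1 Load-bearing analysis -/

/-! ### `2 ≤ N` is decoration -/

/-- The restriction `2 ≤ N` in the crux is NOT load-bearing: `T_s(0) = T_s(1) = 0`, so the bound
for all `N : ℕ` follows with the constant `max C 0`. (Information for the prover: nothing to
exploit or to fear at small `N`.) [folklore] -/
theorem lawAt_iff_forall_nat (s e : ℝ) :
    LawAt s e ↔ ∃ C : ℝ, ∀ N : ℕ, (mkCount s N : ℝ) ≤ C * (N : ℝ) ^ (s - 1 + e) := by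
  constructor
  · rintro ⟨C, hC⟩
    refine ⟨max C 0, fun N => ?_⟩
    rcases le_or_gt 2 N with hN | hN
    · exact (hC N hN).trans
        (mul_le_mul_of_nonneg_right (le_max_left _ _) (Real.rpow_nonneg (by positivity) _))
    · rw [mkCount_eq_zero_of_le_one (by omega), Nat.cast_zero]
      exact mul_nonneg (le_max_right _ _) (Real.rpow_nonneg (by positivity) _)
  · rintro ⟨C, hC⟩
    exact ⟨C, fun N _ => hC N⟩

/-! ### `s < 2`: the trivial range `s ≥ 3` -/

/-- All ordered abc triples with `c ≤ N` number at most `(N+1)²` (they are determined by `(a, c)`).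
[folklore] -/
theorem mkCount_le_sq (s : ℝ) (N : ℕ) : mkCount s N ≤ (N + 1) ^ 2 := by
  have hsub : mkSet s N ⊆ (fun p : ℕ × ℕ => (p.1, p.2 - p.1, p.2)) ''
      ((Finset.range (N + 1) ×ˢ Finset.range (N + 1) : Finset (ℕ × ℕ)) : Set (ℕ × ℕ)) := by
    rintro ⟨a, b, c⟩ ⟨⟨ha, hb, habc, -⟩, hcN, -⟩
    simp only at ha hb habc hcN
    refine ⟨(a, c), ?_, ?_⟩
    · simp only [Finset.coe_product, Finset.coe_range, Set.mem_prod, Set.mem_Iio]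
      omega
    · show (a, c - a, c) = (a, b, c)
      rw [← habc, Nat.add_sub_cancel_left]
  calc mkCount s N ≤ ((fun p : ℕ × ℕ => (p.1, p.2 - p.1, p.2)) ''
      ((Finset.range (N + 1) ×ˢ Finset.range (N + 1) : Finset (ℕ × ℕ)) : Set (ℕ × ℕ))).ncard :=
        Set.ncard_le_ncard hsub (Set.Finite.image _ (Finset.finite_toSet _))
    _ ≤ ((Finset.range (N + 1) ×ˢ Finset.range (N + 1) : Finset (ℕ × ℕ)) : Set (ℕ × ℕ)).ncard :=
        Set.ncard_image_le (Finset.finite_toSet _)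
    _ = (N + 1) ^ 2 := by
        rw [Set.ncard_coe_finset, Finset.card_product, Finset.card_range, sq]

/-- For `s ≥ 3` the law holds trivially (`T_s(N) ≤ (N+1)² ≤ 4 N² ≤ 4 N^{s-1+ε}`): the upper
restriction `s < 2` only records the range the route needs; it is not where falsity could hide.
(`2 ≤ s < 3` is Kane 2011, Theorem 2, not reproduced.) [folklore] -/
theorem lawAt_of_three_le {s e : ℝ} (hs : 3 ≤ s) (he : 0 ≤ e) : LawAt s e := by
  refine ⟨4, fun N hN => ?_⟩
  have hN1 : (1 : ℝ) ≤ N := by exact_mod_cast (show 1 ≤ N by omega)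
  have h1 : (mkCount s N : ℝ) ≤ ((N : ℝ) + 1) ^ 2 := by exact_mod_cast mkCount_le_sq s N
  have h2 : ((N : ℝ) + 1) ^ 2 ≤ 4 * (N : ℝ) ^ (2 : ℝ) := by
    rw [Real.rpow_two]; nlinarith
  have h3 : (N : ℝ) ^ (2 : ℝ) ≤ (N : ℝ) ^ (s - 1 + e) :=
    Real.rpow_le_rpow_of_exponent_le hN1 (by linarith)
  linarith

/-! ### `1 < s` is load-bearing (cheaply: below `s = 1` the bound decays but hits persist) -/

/-- The crux with the hypothesis `1 < s` dropped. -/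
def MazurKaneLawWithoutOneLt : Prop :=
  ∀ s : ℝ, s < 2 → ∀ ε : ℝ, 0 < ε → LawAt s ε

/-- `rad(1 · 8 · 9) ≤ 6` (as `72 ∣ 6³`). [folklore] -/
theorem rad_one_eight_nine_le : rad 1 8 9 ≤ 6 := by
  rw [rad_def]
  exact radical_le_of_dvd_pow (by norm_num) (show 1 * 8 * 9 ∣ 6 ^ 3 by norm_num)

/-- `6 ≤ 9^(9/10)` since `6^10 ≤ 9^9`. [folklore] -/
theorem six_le_nine_rpow : (6 : ℝ) ≤ (9 : ℝ) ^ (9 / 10 : ℝ) := by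
  have h : (9 / 10 : ℝ) = ((9 : ℕ) : ℝ) * (10 : ℝ)⁻¹ := by norm_num
  rw [h, Real.rpow_natCast_mul (by norm_num : (0 : ℝ) ≤ 9),
    Real.le_rpow_inv_iff_of_pos (by norm_num) (by positivity) (by norm_num)]
  norm_num

/-- The abc hit `(1, 8, 9)` lies in the counting set at `s = 9/10` for every `N ≥ 9`. [folklore] -/
theorem one_eight_nine_mem {N : ℕ} (hN : 9 ≤ N) : ((1, 8, 9) : ℕ × ℕ × ℕ) ∈ mkSet (9 / 10) N := by
  refine ⟨⟨one_pos, (by norm_num : (0 : ℕ) < 8), rfl, Nat.coprime_one_left 8⟩, hN, ?_⟩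
  show ((rad 1 8 9 : ℕ) : ℝ) ≤ ((9 : ℕ) : ℝ) ^ (9 / 10 : ℝ)
  have h1 : ((rad 1 8 9 : ℕ) : ℝ) ≤ 6 := by exact_mod_cast rad_one_eight_nine_le
  exact h1.trans (by simpa using six_le_nine_rpow)

/-- **`1 < s` cannot be dropped** (cheap form): at `s = 9/10`, `ε = 1/20` the bound
`C · N^{-1/20}` decays while `T_{9/10}(N) ≥ 1` for `N ≥ 9` (the hit `1 + 8 = 9`, `rad = 6 ≤ 9^{0.9}`).
The boundary case `s = 1` itself (`#hits ≤ C_ε N^ε`) is OPEN and not refuted here: Dahmen's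
`exp((log N)^{1/2-ε})` lower bound (tree: `abcHitCount_lower_bound_holds`) is sub-polynomial.
[folklore] -/
theorem mazurKaneLaw_false_without_one_lt : ¬ MazurKaneLawWithoutOneLt := by
  intro h
  obtain ⟨C, hC⟩ := h (9 / 10) (by norm_num) (1 / 20) (by norm_num)
  -- N = M ^ 20 with M > C
  obtain ⟨M, hM2, hMC⟩ : ∃ M : ℕ, 2 ≤ M ∧ C < M := by
    refine ⟨⌈C⌉₊ + 2, by omega, ?_⟩
    have := Nat.le_ceil C
    push_cast
    linarith
  have hN9 : 9 ≤ M ^ 20 := by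
    calc 9 ≤ 2 ^ 20 := by norm_num
      _ ≤ M ^ 20 := Nat.pow_le_pow_left hM2 20
  have hcount : (1 : ℝ) ≤ mkCount (9 / 10) (M ^ 20) := by
    have : 0 < mkCount (9 / 10) (M ^ 20) :=
      (Set.ncard_pos (mkSet_finite _ _)).mpr ⟨_, one_eight_nine_mem hN9⟩
    exact_mod_cast this
  have hM0 : (0 : ℝ) ≤ M := by positivity
  have hpow : (((M ^ 20 : ℕ) : ℝ)) ^ ((9 / 10 : ℝ) - 1 + 1 / 20) = (M : ℝ)⁻¹ := by
    have he : ((9 / 10 : ℝ) - 1 + 1 / 20) = (-1 / 20 : ℝ) := by norm_num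
    rw [he, Nat.cast_pow, ← Real.rpow_natCast_mul hM0]
    have he' : ((20 : ℕ) : ℝ) * (-1 / 20 : ℝ) = -1 := by norm_num
    rw [he', Real.rpow_neg_one]
  have h1 := hC (M ^ 20) (le_trans (by norm_num) hN9)
  rw [hpow] at h1
  have hM0' : (0 : ℝ) < M := by positivity
  have h2 : (1 : ℝ) ≤ C * (M : ℝ)⁻¹ := hcount.trans h1
  rw [← div_eq_mul_inv, le_div_iff₀ hM0'] at h2
  linarith

/-! ### `0 < ε` is load-bearing: the ε-free ("sharp") law is false at every `s = 1 + 1/n`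

Family (`n ≥ 1`): `r = 2^k 3^l` (so `rad r ≤ 6`), `x ≡ 1 (mod 6)` with `x · rad(r) ≤ r`; then
`(xⁿ, rⁿ - xⁿ, rⁿ)` is an abc triple with `rad ≤ x · (rⁿ - xⁿ) · rad(r) < r^{n+1} = c^{1+1/n}`.
For `M = 128 · 4^K` and each `1 ≤ l ≤ K` there is `k` with `r_l = 2^k 3^l ∈ (M/2, M]`, and
`x = 6t + 1`, `t < M/72`, is admissible for every such `l`; distinct `(l,t)` give distinct triples.
Hence `T_{1+1/n}(Mⁿ) ≥ N_{1+1/n}(Mⁿ) ≥ K · ⌊M/72⌋ ≥ K · 4^K`, i.e. `≫ N^{1/n} log N` at `N = Mⁿ`,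
contradicting any bound `C · N^{1/n}`. -/

/-- The crux with `ε = 0` allowed: the SHARP law `T_s(N) ≤ C(s) · N^{s-1}`. -/
def MazurKaneLawSharp : Prop :=
  ∀ s : ℝ, 1 < s → s < 2 → LawAt s 0

/-- `rad(2^k 3^l) ≤ 6`. [folklore] -/
theorem radical_two_pow_mul_three_pow_le (k l : ℕ) : radical (2 ^ k * 3 ^ l) ≤ 6 := by
  refine radical_le_of_dvd_pow (by norm_num) (show 2 ^ k * 3 ^ l ∣ 6 ^ (k + l) from ?_)
  rw [pow_add]
  exact mul_dvd_mul (pow_dvd_pow_of_dvd (by norm_num) k) (pow_dvd_pow_of_dvd (by norm_num) l)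

/-- `((rⁿ : ℕ) : ℝ)^{1+1/n} = r^{n+1}` for `n ≠ 0`. [folklore] -/
theorem cast_pow_rpow_one_add_inv {n : ℕ} (hn : n ≠ 0) (r : ℕ) :
    ((r ^ n : ℕ) : ℝ) ^ (1 + 1 / n : ℝ) = ((r ^ (n + 1) : ℕ) : ℝ) := by
  have hr0 : (0 : ℝ) ≤ r := by positivity
  rw [Nat.cast_pow, ← Real.rpow_natCast_mul hr0, Nat.cast_pow]
  have hn0 : (n : ℝ) ≠ 0 := by exact_mod_cast hn
  have : (n : ℝ) * (1 + 1 / n) = ((n + 1 : ℕ) : ℝ) := by push_cast; field_simp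
  rw [this, Real.rpow_natCast]

/-- `((Mⁿ : ℕ) : ℝ)^{1/n} = M` for `n ≠ 0`. [folklore] -/
theorem cast_pow_rpow_inv {n : ℕ} (hn : n ≠ 0) (M : ℕ) :
    ((M ^ n : ℕ) : ℝ) ^ (1 / n : ℝ) = M := by
  have hM0 : (0 : ℝ) ≤ M := by positivity
  rw [Nat.cast_pow, ← Real.rpow_natCast_mul hM0]
  have hn0 : (n : ℝ) ≠ 0 := by exact_mod_cast hn
  have he' : (n : ℝ) * (1 / n : ℝ) = 1 := by field_simp
  rw [he', Real.rpow_one]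

/-- The power family, STRICT form: for `n ≥ 1`, `0 < x < r`, `gcd(x,r) = 1`, `x · rad(r) ≤ r`, the
triple `(xⁿ, rⁿ - xⁿ, rⁿ)` is an abc triple with `rad(abc) ≤ r (rⁿ - xⁿ) < r^{n+1} = c^{1+1/n}`, i.e.
it is counted by Literature's `abcExponentCount (1 + 1/n)` (Bernert et al.'s `N_{1+1/n}`).
[folklore] -/
theorem pow_family2_mem_strict {n x r N : ℕ} (hn : 1 ≤ n) (hx : 0 < x) (hxr : x < r)
    (hcop : Nat.Coprime x r) (hrad : x * radical r ≤ r) (hN : r ^ n ≤ N) :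
    ((x ^ n, r ^ n - x ^ n, r ^ n) : ℕ × ℕ × ℕ) ∈
      {t : ℕ × ℕ × ℕ | IsABCTriple t.1 t.2.1 t.2.2 ∧ t.2.2 ≤ N ∧
        ((rad t.1 t.2.1 t.2.2 : ℕ) : ℝ) < (t.2.2 : ℝ) ^ (1 + 1 / n : ℝ)} := by
  have hn0 : n ≠ 0 := by omega
  have hx2 : x ^ n < r ^ n := Nat.pow_lt_pow_left hxr hn0
  refine ⟨⟨pow_pos hx n, Nat.sub_pos_of_lt hx2, Nat.add_sub_cancel' hx2.le, ?_⟩, hN, ?_⟩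
  · have h1 : Nat.Coprime (x ^ n) (r ^ n) := Nat.Coprime.pow n n hcop
    have h2 : r ^ n = r ^ n - x ^ n + x ^ n := (Nat.sub_add_cancel hx2.le).symm
    rw [h2] at h1
    exact Nat.coprime_add_self_right.mp h1
  · show ((rad (x ^ n) (r ^ n - x ^ n) (r ^ n) : ℕ) : ℝ) < ((r ^ n : ℕ) : ℝ) ^ (1 + 1 / n : ℝ)
    rw [cast_pow_rpow_one_add_inv hn0]
    have hr : 0 < r := by omega
    have hnat : rad (x ^ n) (r ^ n - x ^ n) (r ^ n) < r ^ (n + 1) :=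
      calc rad (x ^ n) (r ^ n - x ^ n) (r ^ n) = radical (x ^ n * (r ^ n - x ^ n) * r ^ n) := rfl
        _ ≤ radical (x ^ n) * radical (r ^ n - x ^ n) * radical (r ^ n) :=
            radical_mul_three_le _ _ _
        _ = radical x * radical (r ^ n - x ^ n) * radical r := by
            rw [radical_pow x hn0, radical_pow r hn0]
        _ ≤ x * (r ^ n - x ^ n) * radical r :=
            Nat.mul_le_mul_right _ (Nat.mul_le_mul (Nat.radical_le_self_iff.mpr hx.ne')
              (Nat.radical_le_self_iff.mpr (Nat.sub_pos_of_lt hx2).ne'))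
        _ = x * radical r * (r ^ n - x ^ n) := by ring
        _ ≤ r * (r ^ n - x ^ n) := Nat.mul_le_mul_right _ hrad
        _ < r * r ^ n := Nat.mul_lt_mul_of_pos_left (Nat.sub_lt (by positivity) (by positivity)) hr
        _ = r ^ (n + 1) := by ring
    exact_mod_cast hnat

/-- The power family in the crux's (non-strict) counting set. [folklore] -/
theorem pow_family2_mem {n x r N : ℕ} (hn : 1 ≤ n) (hx : 0 < x) (hxr : x < r)
    (hcop : Nat.Coprime x r) (hrad : x * radical r ≤ r) (hN : r ^ n ≤ N) :
    ((x ^ n, r ^ n - x ^ n, r ^ n) : ℕ × ℕ × ℕ) ∈ mkSet (1 + 1 / n) N := by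
  obtain ⟨ht, hN', hlt⟩ := pow_family2_mem_strict hn hx hxr hcop hrad hN
  exact ⟨ht, hN', hlt.le⟩

/-- Counting through the power family: a finite set `P` of admissible pairs `(x, r)` with
`rⁿ ≤ N` injects into Literature's strict counting set at `1 + 1/n`. [folklore] -/
theorem card_le_abcExponentCount_one_add_inv {n : ℕ} (hn : 1 ≤ n) (N : ℕ) (P : Finset (ℕ × ℕ))
    (hP : ∀ p ∈ P, 0 < p.1 ∧ p.1 < p.2 ∧ Nat.Coprime p.1 p.2 ∧ p.1 * radical p.2 ≤ p.2 ∧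
      p.2 ^ n ≤ N) :
    P.card ≤ abcExponentCount (1 + 1 / n) N := by
  have hn0 : n ≠ 0 := by omega
  have hinj : Set.InjOn (fun p : ℕ × ℕ => (p.1 ^ n, p.2 ^ n - p.1 ^ n, p.2 ^ n)) P := by
    rintro ⟨x, r⟩ - ⟨x', r'⟩ - h
    simp only [Prod.mk.injEq] at h
    obtain ⟨h1, -, h3⟩ := h
    rw [Nat.pow_left_injective hn0 h1, Nat.pow_left_injective hn0 h3]
  rw [abcExponentCount]
  calc P.card = (P.image fun p : ℕ × ℕ => (p.1 ^ n, p.2 ^ n - p.1 ^ n, p.2 ^ n)).card :=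
        (Finset.card_image_of_injOn hinj).symm
    _ = ((P.image fun p : ℕ × ℕ => (p.1 ^ n, p.2 ^ n - p.1 ^ n, p.2 ^ n) : Finset _) :
          Set (ℕ × ℕ × ℕ)).ncard := (Set.ncard_coe_finset _).symm
    _ ≤ _ := by
        refine Set.ncard_le_ncard ?_ (abcExponentCount_finite _ _)
        intro t ht
        rw [Finset.mem_coe, Finset.mem_image] at ht
        obtain ⟨⟨x, r⟩, hp, rfl⟩ := ht
        obtain ⟨hx, hxr, hcop, hrad, hN⟩ := hP _ hp
        exact pow_family2_mem_strict hn hx hxr hcop hrad hN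

/-- `r_l(M) = 2^{⌊log₂ (M / 3^l)⌋} · 3^l`, the largest `2^k 3^l ≤ M` with the given `l`. -/
def rfun (M l : ℕ) : ℕ := 2 ^ Nat.log 2 (M / 3 ^ l) * 3 ^ l

/-- `r_l ≤ M` as soon as `2 · 3^l ≤ M`. [folklore] -/
theorem rfun_le {M l : ℕ} (h : 2 * 3 ^ l ≤ M) : rfun M l ≤ M := by
  have h3 : 0 < 3 ^ l := by positivity
  have hq : M / 3 ^ l ≠ 0 := by
    have : 2 ≤ M / 3 ^ l := (Nat.le_div_iff_mul_le h3).mpr h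
    omega
  calc rfun M l = 2 ^ Nat.log 2 (M / 3 ^ l) * 3 ^ l := rfl
    _ ≤ (M / 3 ^ l) * 3 ^ l := Nat.mul_le_mul_right _ (Nat.pow_log_le_self 2 hq)
    _ ≤ M := Nat.div_mul_le_self M (3 ^ l)

/-- `M < 2 r_l`. [folklore] -/
theorem lt_two_mul_rfun (M l : ℕ) : M < 2 * rfun M l := by
  have h3 : 0 < 3 ^ l := by positivity
  have h1 : M / 3 ^ l < 2 ^ (Nat.log 2 (M / 3 ^ l)).succ := Nat.lt_pow_succ_log_self one_lt_two _
  have h2 : M < 2 ^ (Nat.log 2 (M / 3 ^ l)).succ * 3 ^ l := (Nat.div_lt_iff_lt_mul h3).mp h1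
  calc M < 2 ^ (Nat.log 2 (M / 3 ^ l)).succ * 3 ^ l := h2
    _ = 2 * rfun M l := by rw [rfun, pow_succ]; ring

/-- `rad(r_l) ≤ 6`. [folklore] -/
theorem radical_rfun_le (M l : ℕ) : radical (rfun M l) ≤ 6 :=
  radical_two_pow_mul_three_pow_le _ _

/-- Numbers prime to `6` are prime to `r_l`. [folklore] -/
theorem coprime_rfun {x : ℕ} (hx : Nat.Coprime x 6) (M l : ℕ) : Nat.Coprime x (rfun M l) := by
  have h2 : Nat.Coprime x 2 := hx.coprime_dvd_right (by norm_num)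
  have h3 : Nat.Coprime x 3 := hx.coprime_dvd_right (by norm_num)
  exact Nat.Coprime.mul_right (h2.pow_right _) (h3.pow_right _)

/-- The `3`-adic valuation of `2^k 3^l` is `l`. [folklore] -/
theorem factorization_two_pow_mul_three_pow (k l : ℕ) : (2 ^ k * 3 ^ l).factorization 3 = l := by
  rw [Nat.factorization_mul (pow_ne_zero k (by norm_num)) (pow_ne_zero l (by norm_num)),
    Finsupp.add_apply, Nat.factorization_pow, Nat.factorization_pow, Finsupp.smul_apply,
    Finsupp.smul_apply, smul_eq_mul, smul_eq_mul, Nat.Prime.factorization_self Nat.prime_three,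
    Nat.factorization_eq_zero_of_not_dvd (by norm_num : ¬ 3 ∣ 2)]
  ring

/-- `l ↦ r_l` is injective. [folklore] -/
theorem rfun_injective (M : ℕ) : Function.Injective (rfun M) := by
  intro l l' h
  have h1 := congrArg (fun n => n.factorization 3) h
  simpa only [rfun, factorization_two_pow_mul_three_pow] using h1

/-- `6t + 1` is prime to `6`. [folklore] -/
theorem coprime_six_mul_add_one (t : ℕ) : Nat.Coprime (6 * t + 1) 6 := by
  rw [Nat.coprime_mul_left_add_left]
  exact Nat.coprime_one_left 6

/-- The admissible pairs at height parameter `M = 128 · 4^K`: the image of `[1,K] × [0, M/72)` under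
`(l, t) ↦ (6t+1, r_l)`; it has `K · ⌊M/72⌋` elements, all admissible with `r ≤ M`. [folklore] -/
theorem admissible_pairs (K : ℕ) :
    ∃ P : Finset (ℕ × ℕ), P.card = K * (128 * 4 ^ K / 72) ∧
      ∀ p ∈ P, 0 < p.1 ∧ p.1 < p.2 ∧ Nat.Coprime p.1 p.2 ∧ p.1 * radical p.2 ≤ p.2 ∧
        p.2 ≤ 128 * 4 ^ K := by
  set M : ℕ := 128 * 4 ^ K with hM
  set T : ℕ := M / 72 with hT
  have hT72 : 72 * T ≤ M := Nat.mul_div_le M 72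
  have h3l : ∀ l, l ≤ K → 2 * 3 ^ l ≤ M := by
    intro l hl
    calc 2 * 3 ^ l ≤ 2 * 4 ^ K :=
          Nat.mul_le_mul_left 2 ((Nat.pow_le_pow_left (by norm_num) l).trans
            (Nat.pow_le_pow_right (by norm_num) hl))
      _ ≤ 128 * 4 ^ K := Nat.mul_le_mul_right _ (by norm_num)
  set f : ℕ × ℕ → ℕ × ℕ := fun q => (6 * q.2 + 1, rfun M q.1) with hf
  have hinj : Set.InjOn f ((Finset.Icc 1 K ×ˢ Finset.range T : Finset (ℕ × ℕ)) : Set (ℕ × ℕ)) := by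
    rintro ⟨l, t⟩ - ⟨l', t'⟩ - h
    simp only [hf, Prod.mk.injEq] at h
    obtain ⟨h1, h2⟩ := h
    have hl : l = l' := rfun_injective M h2
    subst hl
    simp only [Prod.mk.injEq, true_and]
    omega
  refine ⟨(Finset.Icc 1 K ×ˢ Finset.range T).image f, ?_, fun p hp => ?_⟩
  · rw [Finset.card_image_of_injOn hinj, Finset.card_product, Nat.card_Icc, Finset.card_range]
    simp [hT, hM]
  rw [Finset.mem_image] at hp
  obtain ⟨⟨l, t⟩, hq, rfl⟩ := hp
  rw [Finset.mem_product, Finset.mem_Icc, Finset.mem_range] at hq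
  obtain ⟨⟨hl1, hlK⟩, htT⟩ := hq
  simp only [hf]
  have hr2 : M < 2 * rfun M l := lt_two_mul_rfun M l
  have hrM : rfun M l ≤ M := rfun_le (h3l l hlK)
  have ht : 72 * (t + 1) ≤ M := le_trans (Nat.mul_le_mul_left 72 htT) hT72
  have hx36 : 36 * (t + 1) < rfun M l := by omega
  refine ⟨by omega, by omega, coprime_rfun (coprime_six_mul_add_one t) M l, ?_, hrM⟩
  calc (6 * t + 1) * radical (rfun M l) ≤ (6 * t + 1) * 6 :=
        Nat.mul_le_mul_left _ (radical_rfun_le M l)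
    _ ≤ rfun M l := by omega

/-- THE LOWER BOUND (strict/Literature form): `N_{1+1/n}((128 · 4^K)ⁿ) ≥ K · ⌊(128 · 4^K) / 72⌋`
for every `n ≥ 1`. [folklore] -/
theorem abcExponentCount_one_add_inv_ge {n : ℕ} (hn : 1 ≤ n) (K : ℕ) :
    K * (128 * 4 ^ K / 72) ≤ abcExponentCount (1 + 1 / n) ((128 * 4 ^ K) ^ n) := by
  obtain ⟨P, hcard, hP⟩ := admissible_pairs K
  rw [← hcard]
  refine card_le_abcExponentCount_one_add_inv hn _ P (fun p hp => ?_)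
  obtain ⟨h1, h2, h3, h4, h5⟩ := hP p hp
  exact ⟨h1, h2, h3, h4, Nat.pow_le_pow_left h5 n⟩

/-- THE LOWER BOUND, crux form: `T_{1+1/n}((128 · 4^K)ⁿ) ≥ K · ⌊(128 · 4^K) / 72⌋`. [folklore] -/
theorem mkCount_one_add_inv_ge {n : ℕ} (hn : 1 ≤ n) (K : ℕ) :
    K * (128 * 4 ^ K / 72) ≤ mkCount (1 + 1 / n) ((128 * 4 ^ K) ^ n) :=
  (abcExponentCount_one_add_inv_ge hn K).trans (abcExponentCount_le_mkCount _ _)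

/-- From a bound `count((128·4^K)ⁿ) ≤ C · 128 · 4^K` valid for all `K` and the lower bound
`K · ⌊128·4^K/72⌋ ≤ count((128·4^K)ⁿ)`, a contradiction. (Shared arithmetic.) [folklore] -/
theorem no_bound_of_family {n : ℕ} {count : ℕ → ℕ}
    (hlow : ∀ K : ℕ, K * (128 * 4 ^ K / 72) ≤ count ((128 * 4 ^ K) ^ n))
    {C : ℝ} (hup : ∀ K : ℕ, (count ((128 * 4 ^ K) ^ n) : ℝ) ≤ C * (128 * (4 : ℝ) ^ K)) :
    False := by
  obtain ⟨K, hKC⟩ : ∃ K : ℕ, 128 * C < K := by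
    refine ⟨⌈128 * C⌉₊ + 1, ?_⟩
    have := Nat.le_ceil (128 * C)
    push_cast
    linarith
  have hT : 4 ^ K ≤ 128 * 4 ^ K / 72 := by
    calc 4 ^ K = 128 * 4 ^ K / 128 := by rw [Nat.mul_div_cancel_left _ (by norm_num)]
      _ ≤ 128 * 4 ^ K / 72 := Nat.div_le_div_left (by norm_num) (by norm_num)
  have h2 : (K : ℝ) * (4 : ℝ) ^ K ≤ C * (128 * (4 : ℝ) ^ K) := by
    have h3 : ((K * (128 * 4 ^ K / 72) : ℕ) : ℝ) ≤ C * (128 * (4 : ℝ) ^ K) :=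
      le_trans (by exact_mod_cast hlow K) (hup K)
    have h4 : (K : ℝ) * (4 : ℝ) ^ K ≤ ((K * (128 * 4 ^ K / 72) : ℕ) : ℝ) := by
      have : K * 4 ^ K ≤ K * (128 * 4 ^ K / 72) := Nat.mul_le_mul_left K hT
      exact_mod_cast this
    linarith
  have h4K : (0 : ℝ) < (4 : ℝ) ^ K := by positivity
  have h6 : (K : ℝ) ≤ 128 * C := by
    refine le_of_mul_le_mul_right ?_ h4K
    linarith
  linarith

/-- `2 ≤ (128 · 4^K)ⁿ` for `n ≥ 1`. [folklore] -/
theorem two_le_height {n : ℕ} (hn : 1 ≤ n) (K : ℕ) : 2 ≤ (128 * 4 ^ K) ^ n := by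
  have : 1 ≤ 4 ^ K := Nat.one_le_pow _ _ (by norm_num)
  calc 2 ≤ 128 * 4 ^ K := by omega
    _ ≤ (128 * 4 ^ K) ^ n := Nat.le_self_pow (by omega) _

/-- **Mazur's question in its literal, ε-free form has a negative answer at every
`λ = 1 + 1/n`, `n ≥ 1`**: `N_{1+1/n}(X)` (Bernert–Browning–Lichtman–Teräväinen's counting function,
tree `abcExponentCount`) is NOT `O(X^{1/n})` — "exact order `X^{λ-1}`" (BLT arXiv:2410.12234
p. 3: "Given a fixed λ > 1, [Mazur] asked whether or not N_λ(X) has exact order X^{λ−1}") fails on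
the upper side by at least a factor `log X` along `λ = 2, 3/2, 4/3, 5/4, … → 1`. The `X^{±ε}` of
Kane's Conjecture 1 (and of the crux) is the correct formulation. [folklore] -/
theorem abcExponentCount_one_add_inv_not_bigO {n : ℕ} (hn : 1 ≤ n) :
    ¬ ∃ C : ℝ, ∀ N : ℕ, 2 ≤ N →
      (abcExponentCount (1 + 1 / n) N : ℝ) ≤ C * (N : ℝ) ^ (1 / n : ℝ) := by
  rintro ⟨C, hC⟩
  refine no_bound_of_family (abcExponentCount_one_add_inv_ge hn) (C := C) (fun K => ?_)
  have h1 := hC ((128 * 4 ^ K) ^ n) (two_le_height hn K)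
  rw [cast_pow_rpow_inv (by omega)] at h1
  have h5 : ((128 * 4 ^ K : ℕ) : ℝ) = 128 * (4 : ℝ) ^ K := by push_cast; ring
  rwa [h5] at h1

/-- The same at `λ = 3/2` with the numeral (for citation): `N_{3/2}(X) ≠ O(√X)`. [folklore] -/
theorem abcExponentCount_three_halves_not_bigO_sqrt :
    ¬ ∃ C : ℝ, ∀ N : ℕ, 2 ≤ N → (abcExponentCount (3 / 2) N : ℝ) ≤ C * (N : ℝ) ^ (1 / 2 : ℝ) := by
  have h := abcExponentCount_one_add_inv_not_bigO (n := 2) (by norm_num)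
  have he : (1 + 1 / (2 : ℕ) : ℝ) = 3 / 2 := by norm_num
  have he' : (1 / (2 : ℕ) : ℝ) = 1 / 2 := by norm_num
  rwa [he, he'] at h

/-- **The sharp law fails at every `s = 1 + 1/n`, `n ≥ 2`**: no `C` with
`T_{1+1/n}(N) ≤ C · N^{1/n}` for all `N ≥ 2`. [folklore] -/
theorem not_lawAt_one_add_inv_zero {n : ℕ} (hn : 2 ≤ n) : ¬ LawAt (1 + 1 / n) 0 := by
  rintro ⟨C, hC⟩
  refine no_bound_of_family (mkCount_one_add_inv_ge (by omega : 1 ≤ n)) (C := C) (fun K => ?_)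
  have h1 := hC ((128 * 4 ^ K) ^ n) (two_le_height (by omega) K)
  have he : ((1 + 1 / n : ℝ) - 1 + 0) = (1 / n : ℝ) := by ring
  rw [he, cast_pow_rpow_inv (by omega)] at h1
  have h5 : ((128 * 4 ^ K : ℕ) : ℝ) = 128 * (4 : ℝ) ^ K := by push_cast; ring
  rwa [h5] at h1

/-- **`0 < ε` cannot be dropped**: the sharp law `T_s(N) ≤ C(s) N^{s-1}` (`1 < s < 2`) is FALSE
(witness `s = 3/2 = 1 + 1/2`; by `not_lawAt_one_add_inv_zero` it is false at every `s = 1 + 1/n`,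
`n ≥ 2`, a sequence accumulating at the delicate endpoint `s = 1`). So any proof of the crux must
lose at least a logarithm: `T_{1+1/n}(N) ≥ c_n N^{1/n} log N`; the `X^{o(1)}` in Mazur's
`X^{λ-1+o(1)}` is not an artefact. [folklore] -/
theorem mazurKaneLaw_false_without_eps : ¬ MazurKaneLawSharp := by
  intro h
  have h2 := h (1 + 1 / (2 : ℕ)) (by norm_num) (by norm_num)
  exact not_lawAt_one_add_inv_zero (le_refl 2) h2

/-! ### The sharp law fails at EVERY `s ∈ (1,2)`: the smooth-height family `(1, c - 1, c)`

`c = r · m` with `r = r_l = 2^k 3^l ∈ (R/2, R]` (`rad r ≤ 6`) and `m ≡ 1 (mod 6)`, `m ≤ M₀`: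
`rad((c-1) c) ≤ (c-1) · 6m < c^s` as soon as `6 m^{2-s} ≤ r^{s-1}`, which holds for all such pairs
once `6 M₀^{2-s} ≤ (R/2)^{s-1}`. With `M₀ = ⌊((R/2)^{s-1}/6)^{1/(2-s)}⌋` this gives
`N_s(R M₀) ≥ K ⌊M₀/6⌋` against `C (R M₀)^{s-1} < 12 C (M₀ + 1)`: impossible for `K > 144 C`. So
`N_s(X) ≥ c_s X^{s-1} log X` for every `s ∈ (1,2)` — Mazur's literal "exact order `X^{λ-1}`" fails
(upper side) on the whole interval, and the crux's `ε` is needed everywhere. -/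

/-- `m^{2-s} · m^{s-1} = m` for `m > 0`. [folklore] -/
theorem rpow_two_sub_mul_rpow_sub_one (s : ℝ) {m : ℝ} (hm : 0 < m) :
    m ^ (2 - s) * m ^ (s - 1) = m := by
  rw [← Real.rpow_add hm]
  have : (2 - s) + (s - 1) = (1 : ℝ) := by ring
  rw [this, Real.rpow_one]

/-- The smooth-height family, STRICT form: if `rad r ≤ 6`, `1 ≤ m`, `2 ≤ r m ≤ N` and
`6 m^{2-s} ≤ r^{s-1}`, then `(1, rm - 1, rm)` is an abc triple with `rad < c^s`. [folklore] -/
theorem smooth_family_mem_strict {s : ℝ} {r m N : ℕ} (hm : 1 ≤ m) (hradr : radical r ≤ 6)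
    (hB : 6 * (m : ℝ) ^ (2 - s) ≤ (r : ℝ) ^ (s - 1)) (h2 : 2 ≤ r * m) (hN : r * m ≤ N) :
    ((1, r * m - 1, r * m) : ℕ × ℕ × ℕ) ∈
      {t : ℕ × ℕ × ℕ | IsABCTriple t.1 t.2.1 t.2.2 ∧ t.2.2 ≤ N ∧
        ((rad t.1 t.2.1 t.2.2 : ℕ) : ℝ) < (t.2.2 : ℝ) ^ s} := by
  have hr : 0 < r := Nat.pos_of_ne_zero (fun h => by simp [h] at h2)
  refine ⟨⟨one_pos, ?_, ?_, Nat.coprime_one_left _⟩, hN, ?_⟩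
  · show 0 < r * m - 1
    omega
  · show 1 + (r * m - 1) = r * m
    omega
  show ((rad 1 (r * m - 1) (r * m) : ℕ) : ℝ) < ((r * m : ℕ) : ℝ) ^ s
  -- in ℕ: rad ≤ (rm - 1) · 6m < rm · 6m
  have hnat : rad 1 (r * m - 1) (r * m) < r * m * (6 * m) := by
    calc rad 1 (r * m - 1) (r * m) = radical (1 * (r * m - 1) * (r * m)) := rfl
      _ ≤ radical 1 * radical (r * m - 1) * radical (r * m) := radical_mul_three_le _ _ _
      _ = radical (r * m - 1) * radical (r * m) := by rw [radical_one, one_mul]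
      _ ≤ (r * m - 1) * (radical r * radical m) :=
          Nat.mul_le_mul (Nat.radical_le_self_iff.mpr (by omega))
            (Nat.le_of_dvd (Nat.mul_pos (Nat.radical_pos _) (Nat.radical_pos _)) radical_mul_dvd)
      _ ≤ (r * m - 1) * (6 * m) :=
          Nat.mul_le_mul_left _ (Nat.mul_le_mul hradr (Nat.radical_le_self_iff.mpr (by omega)))
      _ < r * m * (6 * m) := Nat.mul_lt_mul_of_pos_right (Nat.sub_lt (by omega) one_pos) (by omega)
  -- in ℝ: rm · 6m ≤ (rm)^s
  have hm0 : (0 : ℝ) < m := by exact_mod_cast hm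
  have hr0 : (0 : ℝ) ≤ r := by positivity
  have hreal : ((r * m * (6 * m) : ℕ) : ℝ) ≤ ((r * m : ℕ) : ℝ) ^ s := by
    have h6m : 6 * (m : ℝ) ≤ ((r : ℝ) * m) ^ (s - 1) := by
      calc 6 * (m : ℝ) = 6 * (m : ℝ) ^ (2 - s) * (m : ℝ) ^ (s - 1) := by
            rw [mul_assoc, rpow_two_sub_mul_rpow_sub_one s hm0]
        _ ≤ (r : ℝ) ^ (s - 1) * (m : ℝ) ^ (s - 1) :=
            mul_le_mul_of_nonneg_right hB (Real.rpow_nonneg hm0.le _)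
        _ = ((r : ℝ) * m) ^ (s - 1) := (Real.mul_rpow hr0 hm0.le).symm
    have hrm0 : (0 : ℝ) < (r : ℝ) * m := by positivity
    calc ((r * m * (6 * m) : ℕ) : ℝ) = ((r : ℝ) * m) * (6 * m) := by push_cast; ring
      _ ≤ ((r : ℝ) * m) * ((r : ℝ) * m) ^ (s - 1) := mul_le_mul_of_nonneg_left h6m hrm0.le
      _ = ((r : ℝ) * m) ^ s := by
          have hadd := Real.rpow_add hrm0 1 (s - 1)
          rw [Real.rpow_one] at hadd
          rw [← hadd]
          ring_nf
      _ = ((r * m : ℕ) : ℝ) ^ s := by push_cast; ring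
  exact lt_of_lt_of_le (by exact_mod_cast hnat) hreal

/-- `v₃(r_l · m) = l` when `3 ∤ m`. [folklore] -/
theorem factorization_three_rfun_mul {M l m : ℕ} (hm0 : m ≠ 0) (hm3 : ¬ 3 ∣ m) :
    (rfun M l * m).factorization 3 = l := by
  have hr0 : rfun M l ≠ 0 := by unfold rfun; positivity
  rw [Nat.factorization_mul hr0 hm0, Finsupp.add_apply, rfun, factorization_two_pow_mul_three_pow,
    Nat.factorization_eq_zero_of_not_dvd hm3, add_zero]

/-- THE LOWER BOUND at a general `s ∈ (1,2)` (strict/Literature form): if `6 M₀^{2-s} ≤ (M/2)^{s-1}`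
for `M = 128 · 4^K`, then `N_s(M · M₀) ≥ K · ⌊M₀/6⌋` (pairs `(r_l, 6t+1)`, `1 ≤ l ≤ K`, `t < M₀/6`).
[folklore] -/
theorem smooth_count_ge {s : ℝ} (hs1 : 1 < s) (hs2 : s < 2) (K M₀ : ℕ)
    (hcond : 6 * (M₀ : ℝ) ^ (2 - s) ≤ (((128 * 4 ^ K : ℕ) : ℝ) / 2) ^ (s - 1)) :
    K * (M₀ / 6) ≤ abcExponentCount s (128 * 4 ^ K * M₀) := by
  set M : ℕ := 128 * 4 ^ K with hM
  set T : ℕ := M₀ / 6 with hT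
  have hT6 : 6 * T ≤ M₀ := Nat.mul_div_le M₀ 6
  have h3l : ∀ l, l ≤ K → 2 * 3 ^ l ≤ M := by
    intro l hl
    calc 2 * 3 ^ l ≤ 2 * 4 ^ K :=
          Nat.mul_le_mul_left 2 ((Nat.pow_le_pow_left (by norm_num) l).trans
            (Nat.pow_le_pow_right (by norm_num) hl))
      _ ≤ 128 * 4 ^ K := Nat.mul_le_mul_right _ (by norm_num)
  set f : ℕ × ℕ → ℕ × ℕ × ℕ :=
    fun q => (1, rfun M q.1 * (6 * q.2 + 1) - 1, rfun M q.1 * (6 * q.2 + 1)) with hf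
  have hinj : Set.InjOn f ((Finset.Icc 1 K ×ˢ Finset.range T : Finset (ℕ × ℕ)) : Set (ℕ × ℕ)) := by
    rintro ⟨l, t⟩ - ⟨l', t'⟩ - h
    simp only [hf, Prod.mk.injEq] at h
    obtain ⟨-, -, h3⟩ := h
    have hl : l = l' := by
      have h4 := congrArg (fun n => n.factorization 3) h3
      rwa [factorization_three_rfun_mul (by omega) (by omega),
        factorization_three_rfun_mul (by omega) (by omega)] at h4
    subst hl
    have hr0 : 0 < rfun M l := by unfold rfun; positivity
    have h5 := Nat.eq_of_mul_eq_mul_left hr0 h3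
    simp only [Prod.mk.injEq, true_and]
    omega
  have hcard : ((Finset.Icc 1 K ×ˢ Finset.range T).image f).card = K * T := by
    rw [Finset.card_image_of_injOn hinj, Finset.card_product, Nat.card_Icc, Finset.card_range]
    simp
  rw [← hcard, abcExponentCount]
  calc ((Finset.Icc 1 K ×ˢ Finset.range T).image f).card
      = ((((Finset.Icc 1 K ×ˢ Finset.range T).image f : Finset _) : Set (ℕ × ℕ × ℕ))).ncard :=
        (Set.ncard_coe_finset _).symm
    _ ≤ _ := by
        refine Set.ncard_le_ncard ?_ (abcExponentCount_finite _ _)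
        intro x hx
        rw [Finset.mem_coe, Finset.mem_image] at hx
        obtain ⟨⟨l, t⟩, hq, rfl⟩ := hx
        rw [Finset.mem_product, Finset.mem_Icc, Finset.mem_range] at hq
        obtain ⟨⟨hl1, hlK⟩, htT⟩ := hq
        simp only [hf]
        have hr2 : M < 2 * rfun M l := lt_two_mul_rfun M l
        have hrM : rfun M l ≤ M := rfun_le (h3l l hlK)
        have hmM₀ : 6 * t + 1 ≤ M₀ := by omega
        have hM128 : 128 ≤ M := by
          have : 1 ≤ 4 ^ K := Nat.one_le_pow _ _ (by norm_num)
          omega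
        refine smooth_family_mem_strict (by omega) (radical_rfun_le M l) ?_ ?_ ?_
        · -- 6 (6t+1)^{2-s} ≤ 6 M₀^{2-s} ≤ (M/2)^{s-1} ≤ r^{s-1}
          have h1 : (((6 * t + 1 : ℕ) : ℝ)) ^ (2 - s) ≤ (M₀ : ℝ) ^ (2 - s) :=
            Real.rpow_le_rpow (by positivity) (by exact_mod_cast hmM₀) (by linarith)
          have h2 : (((M : ℕ) : ℝ) / 2) ^ (s - 1) ≤ ((rfun M l : ℕ) : ℝ) ^ (s - 1) := by
            refine Real.rpow_le_rpow (by positivity) ?_ (by linarith)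
            have : ((M : ℕ) : ℝ) < 2 * ((rfun M l : ℕ) : ℝ) := by exact_mod_cast hr2
            linarith
          linarith [h1, h2, hcond]
        · calc 2 ≤ rfun M l := by omega
            _ ≤ rfun M l * (6 * t + 1) := Nat.le_mul_of_pos_right _ (by omega)
        · exact Nat.mul_le_mul hrM hmM₀

/-- `((M₀ - 5)/6 : ℝ) ≤ ⌊M₀/6⌋`. [folklore] -/
theorem sub_five_div_six_le (M₀ : ℕ) : ((M₀ : ℝ) - 5) / 6 ≤ ((M₀ / 6 : ℕ) : ℝ) := by
  have h : M₀ ≤ 6 * (M₀ / 6) + 5 := by omega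
  have h' : (M₀ : ℝ) ≤ 6 * ((M₀ / 6 : ℕ) : ℝ) + 5 := by exact_mod_cast h
  linarith

/-- Height arithmetic: if `(M/2)^{s-1} < 6 (M₀+1)^{2-s}` then `(M M₀)^{s-1} ≤ 12 (M₀ + 1)`
(`1 < s < 2`). [folklore] -/
theorem height_rpow_le {s : ℝ} (hs1 : 1 < s) (hs2 : s < 2) (M M₀ : ℕ)
    (hlt : (((M : ℕ) : ℝ) / 2) ^ (s - 1) < 6 * ((M₀ : ℝ) + 1) ^ (2 - s)) :
    ((M * M₀ : ℕ) : ℝ) ^ (s - 1) ≤ 12 * ((M₀ : ℝ) + 1) := by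
  have hM0 : (0 : ℝ) ≤ (M : ℝ) := by positivity
  have hM₀0 : (0 : ℝ) ≤ (M₀ : ℝ) := by positivity
  have h1 : ((M * M₀ : ℕ) : ℝ) ^ (s - 1) = (M : ℝ) ^ (s - 1) * (M₀ : ℝ) ^ (s - 1) := by
    push_cast
    exact Real.mul_rpow hM0 hM₀0
  have h2 : (M : ℝ) ^ (s - 1) ≤ 2 * (((M : ℕ) : ℝ) / 2) ^ (s - 1) := by
    have hsplit : (M : ℝ) = 2 * ((M : ℝ) / 2) := by ring
    conv_lhs => rw [hsplit]
    rw [Real.mul_rpow (by norm_num) (by positivity)]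
    refine mul_le_mul_of_nonneg_right ?_ (Real.rpow_nonneg (by positivity) _)
    calc (2 : ℝ) ^ (s - 1) ≤ (2 : ℝ) ^ (1 : ℝ) :=
          Real.rpow_le_rpow_of_exponent_le (by norm_num) (by linarith)
      _ = 2 := Real.rpow_one 2
  have h3 : (M₀ : ℝ) ^ (s - 1) ≤ ((M₀ : ℝ) + 1) ^ (s - 1) :=
    Real.rpow_le_rpow hM₀0 (by linarith) (by linarith)
  have h4 : ((M₀ : ℝ) + 1) ^ (2 - s) * ((M₀ : ℝ) + 1) ^ (s - 1) = (M₀ : ℝ) + 1 :=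
    rpow_two_sub_mul_rpow_sub_one s (by positivity)
  have h5 : 0 ≤ (M₀ : ℝ) ^ (s - 1) := Real.rpow_nonneg hM₀0 _
  have h6 : 0 ≤ ((M₀ : ℝ) + 1) ^ (2 - s) := Real.rpow_nonneg (by positivity) _
  rw [h1]
  calc (M : ℝ) ^ (s - 1) * (M₀ : ℝ) ^ (s - 1)
      ≤ (2 * (((M : ℕ) : ℝ) / 2) ^ (s - 1)) * (M₀ : ℝ) ^ (s - 1) :=
        mul_le_mul_of_nonneg_right h2 h5
    _ ≤ (2 * (6 * ((M₀ : ℝ) + 1) ^ (2 - s))) * ((M₀ : ℝ) + 1) ^ (s - 1) := by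
        refine mul_le_mul (by linarith) h3 h5 (by positivity)
    _ = 12 * (((M₀ : ℝ) + 1) ^ (2 - s) * ((M₀ : ℝ) + 1) ^ (s - 1)) := by ring
    _ = 12 * ((M₀ : ℝ) + 1) := by rw [h4]

/-- **Mazur's literal question fails on the whole interval**: for EVERY `s ∈ (1,2)`, `N_s(X)`
(tree `abcExponentCount`, strict `rad < c^s`) is NOT `O(X^{s-1})`; the true size is at least
`c_s X^{s-1} log X` (smooth-height family `(1, c-1, c)`, `c = 2^k 3^l m`). SOURCES, read this
session: Bernert–Browning–Lichtman–Teräväinen arXiv:2410.12234 p. 3 ("Given a fixed λ > 1, [Mazur]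
asked whether or not N_λ(X) has exact order X^{λ−1}") — in this joint-radical reading the answer is
NO on the upper side; Mazur himself (Notices AMS 47 no. 2 (2000) p. 198, "Question (d ≥ 0)": "does it
admit the asymptotics card S(a;b;c;X) ≍ X^d? … would break naturally into two tasks: showing that
X^{d+ε} is an upper bound … and showing that X^{d−ε} is a lower bound") immediately passes to the
`X^{d±ε}` form, which is Kane's Conjecture 1 and the crux's shape. [folklore] -/
theorem abcExponentCount_not_bigO {s : ℝ} (hs1 : 1 < s) (hs2 : s < 2) :
    ¬ ∃ C : ℝ, ∀ N : ℕ, 2 ≤ N → (abcExponentCount s N : ℝ) ≤ C * (N : ℝ) ^ (s - 1) := by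
  rintro ⟨C, hC⟩
  -- WLOG `C ≥ 0`
  set C' : ℝ := max C 0 with hC'def
  have hC'0 : 0 ≤ C' := le_max_right _ _
  have hC' : ∀ N : ℕ, 2 ≤ N → (abcExponentCount s N : ℝ) ≤ C' * (N : ℝ) ^ (s - 1) := fun N hN =>
    (hC N hN).trans (mul_le_mul_of_nonneg_right (le_max_left _ _) (Real.rpow_nonneg (by positivity) _))
  -- choose K: K > 144 C' and 4^K > 66^{1/(s-1)}
  obtain ⟨K₀, hK₀⟩ : ∃ K₀ : ℕ, (66 : ℝ) ^ (s - 1)⁻¹ < 4 ^ K₀ :=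
    pow_unbounded_of_one_lt _ (by norm_num)
  obtain ⟨K, hKC, hKK₀⟩ : ∃ K : ℕ, 144 * C' < K ∧ K₀ ≤ K := by
    refine ⟨⌈144 * C'⌉₊ + 1 + K₀, ?_, by omega⟩
    have h1 := Nat.le_ceil (144 * C')
    have h2 : (0 : ℝ) ≤ (K₀ : ℝ) := by positivity
    push_cast
    linarith
  set M : ℕ := 128 * 4 ^ K with hM
  -- X := (M/2)^{s-1}/6, Y := X^{1/(2-s)}, M₀ := ⌊Y⌋
  set X : ℝ := (((M : ℕ) : ℝ) / 2) ^ (s - 1) / 6 with hX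
  have hX0 : 0 ≤ X := by positivity
  set Y : ℝ := X ^ (2 - s)⁻¹ with hY
  have hY0 : 0 ≤ Y := Real.rpow_nonneg hX0 _
  set M₀ : ℕ := ⌊Y⌋₊ with hM₀
  have hM₀Y : (M₀ : ℝ) ≤ Y := Nat.floor_le hY0
  have hYM₀ : Y < (M₀ : ℝ) + 1 := Nat.lt_floor_add_one Y
  have hYX : Y ^ (2 - s) = X := by rw [hY, Real.rpow_inv_rpow hX0 (by linarith)]
  -- (a) the family condition
  have hcond : 6 * (M₀ : ℝ) ^ (2 - s) ≤ (((M : ℕ) : ℝ) / 2) ^ (s - 1) := by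
    have h1 : (M₀ : ℝ) ^ (2 - s) ≤ Y ^ (2 - s) :=
      Real.rpow_le_rpow (by positivity) hM₀Y (by linarith)
    rw [hYX, hX] at h1
    have h2 : 6 * ((((M : ℕ) : ℝ) / 2) ^ (s - 1) / 6) = (((M : ℕ) : ℝ) / 2) ^ (s - 1) := by ring
    linarith
  -- (b) M₀ ≥ 11
  have hX11 : 11 ≤ X := by
    have h4K : (66 : ℝ) ^ (s - 1)⁻¹ ≤ ((M : ℕ) : ℝ) / 2 := by
      have h1 : (4 : ℝ) ^ K₀ ≤ (4 : ℝ) ^ K := pow_le_pow_right₀ (by norm_num) hKK₀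
      have h2 : ((M : ℕ) : ℝ) / 2 = 64 * (4 : ℝ) ^ K := by rw [hM]; push_cast; ring
      have h3 : (0 : ℝ) ≤ (4 : ℝ) ^ K := by positivity
      rw [h2]
      linarith
    have h66 : (66 : ℝ) ≤ (((M : ℕ) : ℝ) / 2) ^ (s - 1) := by
      have h1 := Real.rpow_le_rpow (by positivity) h4K (by linarith : 0 ≤ s - 1)
      rwa [Real.rpow_inv_rpow (by norm_num) (by linarith : s - 1 ≠ 0)] at h1
    rw [hX]
    linarith
  have hY11 : (11 : ℝ) ≤ Y := by
    by_contra hlt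
    rw [not_le] at hlt
    have h1 : Y ^ (2 - s) < (11 : ℝ) ^ (2 - s) := Real.rpow_lt_rpow hY0 hlt (by linarith)
    have h2 : (11 : ℝ) ^ (2 - s) ≤ (11 : ℝ) ^ (1 : ℝ) :=
      Real.rpow_le_rpow_of_exponent_le (by norm_num) (by linarith)
    rw [Real.rpow_one] at h2
    rw [hYX] at h1
    linarith
  have hM₀11 : 11 ≤ M₀ := by
    have h1 : (10 : ℝ) < (M₀ : ℝ) := by linarith
    have h2 : (10 : ℕ) < M₀ := by exact_mod_cast h1
    omega
  -- (c) lower bound, (d) upper bound at N = M · M₀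
  have hcount := smooth_count_ge hs1 hs2 K M₀ hcond
  have hN2 : 2 ≤ M * M₀ := by
    have : 1 ≤ 4 ^ K := Nat.one_le_pow _ _ (by norm_num)
    calc 2 ≤ M := by omega
      _ ≤ M * M₀ := Nat.le_mul_of_pos_right _ (by omega)
  have hup := hC' (M * M₀) hN2
  have hlt : (((M : ℕ) : ℝ) / 2) ^ (s - 1) < 6 * ((M₀ : ℝ) + 1) ^ (2 - s) := by
    have h1 : Y ^ (2 - s) < ((M₀ : ℝ) + 1) ^ (2 - s) := Real.rpow_lt_rpow hY0 hYM₀ (by linarith)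
    rw [hYX, hX] at h1
    have h2 : 6 * ((((M : ℕ) : ℝ) / 2) ^ (s - 1) / 6) = (((M : ℕ) : ℝ) / 2) ^ (s - 1) := by ring
    linarith
  have hheight := height_rpow_le hs1 hs2 M M₀ hlt
  -- K (M₀ - 5)/6 ≤ K ⌊M₀/6⌋ ≤ N_s ≤ C' (M M₀)^{s-1} ≤ 12 C' (M₀ + 1)
  have h1 : (K : ℝ) * (((M₀ : ℝ) - 5) / 6) ≤ 12 * C' * ((M₀ : ℝ) + 1) := by
    calc (K : ℝ) * (((M₀ : ℝ) - 5) / 6) ≤ (K : ℝ) * ((M₀ / 6 : ℕ) : ℝ) :=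
          mul_le_mul_of_nonneg_left (sub_five_div_six_le M₀) (by positivity)
      _ = ((K * (M₀ / 6) : ℕ) : ℝ) := by push_cast; ring
      _ ≤ (abcExponentCount s (M * M₀) : ℝ) := by exact_mod_cast hcount
      _ ≤ C' * ((M * M₀ : ℕ) : ℝ) ^ (s - 1) := hup
      _ ≤ C' * (12 * ((M₀ : ℝ) + 1)) := mul_le_mul_of_nonneg_left hheight hC'0
      _ = 12 * C' * ((M₀ : ℝ) + 1) := by ring
  -- with M₀ ≥ 11: (M₀ - 5)/6 ≥ (M₀ + 1)/12, so K ≤ 144 C'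
  have hM₀r : (11 : ℝ) ≤ M₀ := by exact_mod_cast hM₀11
  have h2 : (K : ℝ) * (((M₀ : ℝ) + 1) / 12) ≤ 12 * C' * ((M₀ : ℝ) + 1) := by
    have : ((M₀ : ℝ) + 1) / 12 ≤ ((M₀ : ℝ) - 5) / 6 := by linarith
    exact le_trans (mul_le_mul_of_nonneg_left this (by positivity)) h1
  have hpos : (0 : ℝ) < ((M₀ : ℝ) + 1) / 12 := by positivity
  have h3 : (K : ℝ) ≤ 144 * C' := by
    have h4 : (K : ℝ) * (((M₀ : ℝ) + 1) / 12) ≤ (144 * C') * (((M₀ : ℝ) + 1) / 12) := by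
      linarith
    exact le_of_mul_le_mul_right h4 hpos
  linarith

/-- **The sharp law fails at every `s ∈ (1,2)`** (crux form). [folklore] -/
theorem not_lawAt_zero {s : ℝ} (hs1 : 1 < s) (hs2 : s < 2) : ¬ LawAt s 0 := by
  rintro ⟨C, hC⟩
  refine abcExponentCount_not_bigO hs1 hs2 ⟨C, fun N hN => ?_⟩
  have h1 := hC N hN
  rw [add_zero] at h1
  exact le_trans (by exact_mod_cast abcExponentCount_le_mkCount s N) h1

/-- Hence `MazurKaneLawSharp` fails at every single `s`, not only at `s = 1 + 1/n`. [folklore] -/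
theorem mazurKaneLawSharp_false_everywhere {s : ℝ} (hs1 : 1 < s) (hs2 : s < 2)
    (h : MazurKaneLawSharp) : False :=
  not_lawAt_zero hs1 hs2 (h s hs1 hs2)

/-! ### Coprimality (inside `IsABCTriple`) is load-bearing

Without `gcd(a,b) = 1` the count explodes: for `c = 2^{8ν}`, `a = i · 2^{2ν+1}` (`1 ≤ i < 2^{6ν-2}`),
`b = c - a`, one has `rad(abc) ≤ 2i · 2(2^{6ν-1} - i) · 2 < 2^{12ν} = c^{3/2}`: `≍ N^{3/4}` triples of
exponent `3/2` below `N`, against the law's `N^{1/2+ε}`. (Positivity of `a, b` is NOT load-bearing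
given coprimality: `gcd(0,b) = 1` forces `b = 1`, so only the junk triple `(0,1,1)` would enter.) -/

/-- `rad(2^j · i) ≤ 2 i` for `i ≠ 0`. [folklore] -/
theorem radical_two_pow_mul_le {j i : ℕ} (hi : i ≠ 0) : radical (2 ^ j * i) ≤ 2 * i := by
  refine radical_le_of_dvd_pow (by positivity) (show 2 ^ j * i ∣ (2 * i) ^ (max j 1) from ?_)
  rw [mul_pow]
  exact mul_dvd_mul (pow_dvd_pow 2 (le_max_left j 1))
    ((dvd_pow_self i (by omega : max j 1 ≠ 0)))

/-- The non-coprime dyadic family at `s = 3/2`: for `1 ≤ i < 2^{6ν-2}` the triple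
`(i·2^{2ν+1}, 2^{8ν} - i·2^{2ν+1}, 2^{8ν})` has positive entries summing correctly and
`rad(abc) ≤ (2^{8ν})^{3/2}`. [folklore] -/
theorem dyadic_family_mem {ν i N : ℕ} (hi1 : 1 ≤ i) (hi2 : i < 2 ^ (6 * ν - 2)) (hν : 1 ≤ ν)
    (hN : 2 ^ (8 * ν) ≤ N) :
    ((i * 2 ^ (2 * ν + 1), 2 ^ (8 * ν) - i * 2 ^ (2 * ν + 1), 2 ^ (8 * ν)) : ℕ × ℕ × ℕ) ∈
      {t : ℕ × ℕ × ℕ | (0 < t.1 ∧ 0 < t.2.1 ∧ t.1 + t.2.1 = t.2.2) ∧ t.2.2 ≤ N ∧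
        ((rad t.1 t.2.1 t.2.2 : ℕ) : ℝ) ≤ (t.2.2 : ℝ) ^ (3 / 2 : ℝ)} := by
  -- sizes: a = i 2^{2ν+1} < 2^{6ν-2} 2^{2ν+1} = 2^{8ν-1} < c
  have hpow : 2 ^ (6 * ν - 2) * 2 ^ (2 * ν + 1) = 2 ^ (8 * ν - 1) := by
    rw [← pow_add]; congr 1; omega
  have ha_lt : i * 2 ^ (2 * ν + 1) < 2 ^ (8 * ν - 1) := by
    rw [← hpow]; exact Nat.mul_lt_mul_of_pos_right hi2 (by positivity)
  have hc : 2 ^ (8 * ν - 1) < 2 ^ (8 * ν) := Nat.pow_lt_pow_right (by norm_num) (by omega)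
  have halt : i * 2 ^ (2 * ν + 1) < 2 ^ (8 * ν) := ha_lt.trans hc
  refine ⟨⟨by positivity, Nat.sub_pos_of_lt halt, Nat.add_sub_cancel' halt.le⟩, hN, ?_⟩
  show ((rad (i * 2 ^ (2 * ν + 1)) (2 ^ (8 * ν) - i * 2 ^ (2 * ν + 1)) (2 ^ (8 * ν)) : ℕ) : ℝ) ≤
    ((2 ^ (8 * ν) : ℕ) : ℝ) ^ (3 / 2 : ℝ)
  -- the real power: (2^{8ν})^{3/2} = 2^{12ν}
  have hre : ((2 ^ (8 * ν) : ℕ) : ℝ) ^ (3 / 2 : ℝ) = ((2 ^ (12 * ν) : ℕ) : ℝ) := by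
    have h2 : ((2 ^ (8 * ν) : ℕ) : ℝ) = (2 : ℝ) ^ (8 * ν) := by push_cast; ring
    have h3 : ((2 ^ (12 * ν) : ℕ) : ℝ) = (2 : ℝ) ^ (12 * ν) := by push_cast; ring
    rw [h2, h3, ← Real.rpow_natCast_mul (by norm_num : (0 : ℝ) ≤ 2), ← Real.rpow_natCast]
    congr 1
    push_cast
    ring
  rw [hre]
  -- b = 2^{2ν+1} (2^{6ν-1} - i)
  have h6 : 2 ^ (8 * ν) = 2 ^ (2 * ν + 1) * 2 ^ (6 * ν - 1) := by
    rw [← pow_add]; congr 1; omega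
  have hb : 2 ^ (8 * ν) - i * 2 ^ (2 * ν + 1) = 2 ^ (2 * ν + 1) * (2 ^ (6 * ν - 1) - i) := by
    rw [h6, Nat.mul_sub, mul_comm i]
  have hi6 : i < 2 ^ (6 * ν - 1) :=
    hi2.trans (Nat.pow_lt_pow_right (by norm_num) (by omega))
  have hnat : rad (i * 2 ^ (2 * ν + 1)) (2 ^ (8 * ν) - i * 2 ^ (2 * ν + 1)) (2 ^ (8 * ν)) ≤
      2 ^ (12 * ν) := by
    rw [rad_def, hb]
    calc radical (i * 2 ^ (2 * ν + 1) * (2 ^ (2 * ν + 1) * (2 ^ (6 * ν - 1) - i)) * 2 ^ (8 * ν))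
        ≤ radical (i * 2 ^ (2 * ν + 1)) * radical (2 ^ (2 * ν + 1) * (2 ^ (6 * ν - 1) - i)) *
            radical (2 ^ (8 * ν)) := radical_mul_three_le _ _ _
      _ ≤ (2 * i) * (2 * (2 ^ (6 * ν - 1) - i)) * 2 := by
          refine Nat.mul_le_mul (Nat.mul_le_mul ?_ ?_) ?_
          · rw [mul_comm]; exact radical_two_pow_mul_le (by omega)
          · exact radical_two_pow_mul_le (by omega)
          · calc radical (2 ^ (8 * ν)) = radical 2 := radical_pow 2 (by omega)
              _ ≤ 2 := Nat.radical_le_self_iff.mpr two_ne_zero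
      _ = 8 * (i * (2 ^ (6 * ν - 1) - i)) := by ring
      _ ≤ 8 * (2 ^ (6 * ν - 2) * 2 ^ (6 * ν - 1)) :=
          Nat.mul_le_mul_left 8 (Nat.mul_le_mul hi2.le (Nat.sub_le _ _))
      _ = 2 ^ (3 + (6 * ν - 2) + (6 * ν - 1)) := by rw [pow_add, pow_add]; ring
      _ = 2 ^ (12 * ν) := by congr 1; omega
  exact_mod_cast hnat

/-- THE LOWER BOUND without coprimality: `≥ 2^{6ν-2} - 1` triples of exponent `3/2` below
`N = 2^{8ν}` (so `≍ N^{3/4}`). [folklore] -/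
theorem noncoprime_count_ge {ν : ℕ} (hν : 1 ≤ ν) :
    2 ^ (6 * ν - 2) - 1 ≤ Set.ncard {t : ℕ × ℕ × ℕ | (0 < t.1 ∧ 0 < t.2.1 ∧ t.1 + t.2.1 = t.2.2) ∧
      t.2.2 ≤ 2 ^ (8 * ν) ∧ ((rad t.1 t.2.1 t.2.2 : ℕ) : ℝ) ≤ (t.2.2 : ℝ) ^ (3 / 2 : ℝ)} := by
  have hfin : {t : ℕ × ℕ × ℕ | (0 < t.1 ∧ 0 < t.2.1 ∧ t.1 + t.2.1 = t.2.2) ∧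
      t.2.2 ≤ 2 ^ (8 * ν) ∧ ((rad t.1 t.2.1 t.2.2 : ℕ) : ℝ) ≤ (t.2.2 : ℝ) ^ (3 / 2 : ℝ)}.Finite := by
    refine ((Set.finite_Iic (2 ^ (8 * ν))).prod ((Set.finite_Iic (2 ^ (8 * ν))).prod
      (Set.finite_Iic (2 ^ (8 * ν))))).subset ?_
    rintro ⟨a, b, c⟩ ⟨⟨ha, hb, habc⟩, hcX, -⟩
    simp only [Set.mem_prod, Set.mem_Iic] at *
    omega
  have hinj : Set.InjOn (fun i : ℕ => ((i * 2 ^ (2 * ν + 1), 2 ^ (8 * ν) - i * 2 ^ (2 * ν + 1),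
      2 ^ (8 * ν)) : ℕ × ℕ × ℕ)) ((Finset.Ico 1 (2 ^ (6 * ν - 2)) : Finset ℕ) : Set ℕ) := by
    intro i _ i' _ h
    simp only [Prod.mk.injEq] at h
    exact Nat.eq_of_mul_eq_mul_right (by positivity) h.1
  calc 2 ^ (6 * ν - 2) - 1 = (Finset.Ico 1 (2 ^ (6 * ν - 2))).card := by simp
    _ = ((Finset.Ico 1 (2 ^ (6 * ν - 2))).image fun i : ℕ => ((i * 2 ^ (2 * ν + 1),
          2 ^ (8 * ν) - i * 2 ^ (2 * ν + 1), 2 ^ (8 * ν)) : ℕ × ℕ × ℕ)).card :=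
        (Finset.card_image_of_injOn hinj).symm
    _ = (((Finset.Ico 1 (2 ^ (6 * ν - 2))).image fun i : ℕ => ((i * 2 ^ (2 * ν + 1),
          2 ^ (8 * ν) - i * 2 ^ (2 * ν + 1), 2 ^ (8 * ν)) : ℕ × ℕ × ℕ) : Finset _) :
          Set (ℕ × ℕ × ℕ)).ncard := (Set.ncard_coe_finset _).symm
    _ ≤ _ := by
        refine Set.ncard_le_ncard ?_ hfin
        intro t ht
        rw [Finset.mem_coe, Finset.mem_image] at ht
        obtain ⟨i, hi, rfl⟩ := ht
        rw [Finset.mem_Ico] at hi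
        exact dyadic_family_mem hi.1 hi.2 hν le_rfl

/-- **Coprimality cannot be dropped**: the crux with `IsABCTriple a b c` weakened to
`0 < a ∧ 0 < b ∧ a + b = c` is FALSE (witness `s = 3/2`, `ε = 1/8`: `≍ N^{3/4}` dyadic triples
against `C N^{5/8}`). Any proof must use `gcd(a,b) = 1` in an essential (not bookkeeping) way: it
is what excludes the common powerful factor. [folklore] -/
theorem mazurKaneLaw_false_without_coprime :
    ¬ (∀ s : ℝ, 1 < s → s < 2 → ∀ ε : ℝ, 0 < ε → ∃ C : ℝ, ∀ N : ℕ, 2 ≤ N →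
      (Set.ncard {t : ℕ × ℕ × ℕ | (0 < t.1 ∧ 0 < t.2.1 ∧ t.1 + t.2.1 = t.2.2) ∧ t.2.2 ≤ N ∧
        ((rad t.1 t.2.1 t.2.2 : ℕ) : ℝ) ≤ (t.2.2 : ℝ) ^ s} : ℝ) ≤ C * (N : ℝ) ^ (s - 1 + ε)) := by
  intro h
  obtain ⟨C, hC⟩ := h (3 / 2) (by norm_num) (by norm_num) (1 / 8) (by norm_num)
  -- ν = ⌈C⌉₊ + 4, N = 2^{8ν}
  obtain ⟨ν, hν4, hνC⟩ : ∃ ν : ℕ, 4 ≤ ν ∧ C < (2 : ℝ) ^ (ν - 3) := by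
    refine ⟨⌈C⌉₊ + 4, by omega, ?_⟩
    have h1 : C ≤ ⌈C⌉₊ := Nat.le_ceil C
    have h2 : ((⌈C⌉₊ : ℕ) : ℝ) < (2 : ℝ) ^ (⌈C⌉₊ + 1) := by
      have : (⌈C⌉₊ : ℕ) < 2 ^ (⌈C⌉₊ + 1) :=
        (Nat.lt_two_pow_self).trans (Nat.pow_lt_pow_right (by norm_num) (by omega))
      exact_mod_cast this
    have h3 : (⌈C⌉₊ + 4 - 3 : ℕ) = ⌈C⌉₊ + 1 := by omega
    rw [h3]
    linarith
  have hν1 : 1 ≤ ν := by omega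
  have hN2 : 2 ≤ 2 ^ (8 * ν) := by
    calc 2 = 2 ^ 1 := (pow_one 2).symm
      _ ≤ 2 ^ (8 * ν) := Nat.pow_le_pow_right (by norm_num) (by omega)
  have h1 := hC (2 ^ (8 * ν)) hN2
  have hlow := noncoprime_count_ge hν1
  -- the real power: (2^{8ν})^{5/8} = 2^{5ν}
  have hre : ((2 ^ (8 * ν) : ℕ) : ℝ) ^ ((3 / 2 : ℝ) - 1 + 1 / 8) = (2 : ℝ) ^ (5 * ν) := by
    have he : ((3 / 2 : ℝ) - 1 + 1 / 8) = (5 / 8 : ℝ) := by norm_num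
    have h2 : ((2 ^ (8 * ν) : ℕ) : ℝ) = (2 : ℝ) ^ (8 * ν) := by push_cast; ring
    rw [he, h2, ← Real.rpow_natCast_mul (by norm_num : (0 : ℝ) ≤ 2), ← Real.rpow_natCast]
    congr 1
    push_cast
    ring
  rw [hre] at h1
  -- 2^{6ν-3} ≤ 2^{6ν-2} - 1 ≤ count ≤ C 2^{5ν} < 2^{ν-3} 2^{5ν} = 2^{6ν-3}
  have h2 : ((2 ^ (6 * ν - 2) - 1 : ℕ) : ℝ) ≤ C * (2 : ℝ) ^ (5 * ν) :=
    le_trans (by exact_mod_cast hlow) h1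
  have h3 : (2 : ℝ) ^ (6 * ν - 3) ≤ ((2 ^ (6 * ν - 2) - 1 : ℕ) : ℝ) := by
    have : 2 ^ (6 * ν - 3) ≤ 2 ^ (6 * ν - 2) - 1 := by
      have h4 : 2 ^ (6 * ν - 2) = 2 * 2 ^ (6 * ν - 3) := by
        rw [← pow_succ']; congr 1; omega
      have h5 : 1 ≤ 2 ^ (6 * ν - 3) := Nat.one_le_two_pow
      omega
    exact_mod_cast this
  have h4 : (2 : ℝ) ^ (6 * ν - 3) = (2 : ℝ) ^ (ν - 3) * (2 : ℝ) ^ (5 * ν) := by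
    rw [← pow_add]; congr 1; omega
  have h5 : (0 : ℝ) < (2 : ℝ) ^ (5 * ν) := by positivity
  have h6 : (2 : ℝ) ^ (ν - 3) * (2 : ℝ) ^ (5 * ν) ≤ C * (2 : ℝ) ^ (5 * ν) := by
    rw [← h4]; exact h3.trans h2
  have h7 : (2 : ℝ) ^ (ν - 3) ≤ C := le_of_mul_le_mul_right h6 h5
  linarith

/-! ### Transfer: monotonicity in `ε` and in `s` -/

/-- `LawAt s e` is monotone in `e`. [folklore] -/
theorem lawAt_mono {s e e' : ℝ} (h : LawAt s e) (hee : e ≤ e') : LawAt s e' := by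
  obtain ⟨C, hC⟩ := h
  refine ⟨max C 0, fun N hN => ?_⟩
  have hN1 : (1 : ℝ) ≤ N := by exact_mod_cast (show 1 ≤ N by omega)
  calc (mkCount s N : ℝ) ≤ C * (N : ℝ) ^ (s - 1 + e) := hC N hN
    _ ≤ max C 0 * (N : ℝ) ^ (s - 1 + e) :=
        mul_le_mul_of_nonneg_right (le_max_left _ _) (Real.rpow_nonneg (by positivity) _)
    _ ≤ max C 0 * (N : ℝ) ^ (s - 1 + e') :=
        mul_le_mul_of_nonneg_left (Real.rpow_le_rpow_of_exponent_le hN1 (by linarith))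
          (le_max_right _ _)

/-- `T_s(N)` is monotone in `s` (as `c ≥ 1`). [folklore] -/
theorem mkCount_mono_left {s s' : ℝ} (h : s ≤ s') (N : ℕ) : mkCount s N ≤ mkCount s' N := by
  rw [mkCount, mkCount]
  refine Set.ncard_le_ncard ?_ (mkSet_finite s' N)
  rintro ⟨a, b, c⟩ ⟨ht, hcN, hle⟩
  refine ⟨ht, hcN, hle.trans (Real.rpow_le_rpow_of_exponent_le ?_ h)⟩
  exact_mod_cast (show 1 ≤ c from le_trans one_le_two (two_le_of_isABCTriple ht))

/-- A bound at a larger `s'` is a bound at `s ≤ s'` with the same total exponent. [folklore] -/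
theorem lawAt_of_le {s s' e : ℝ} (hss : s ≤ s') (h : LawAt s' e) : LawAt s (e + (s' - s)) := by
  obtain ⟨C, hC⟩ := h
  refine ⟨max C 0, fun N hN => ?_⟩
  have he : s - 1 + (e + (s' - s)) = s' - 1 + e := by ring
  rw [he]
  calc (mkCount s N : ℝ) ≤ mkCount s' N := by exact_mod_cast mkCount_mono_left hss N
    _ ≤ C * (N : ℝ) ^ (s' - 1 + e) := hC N hN
    _ ≤ max C 0 * (N : ℝ) ^ (s' - 1 + e) :=
        mul_le_mul_of_nonneg_right (le_max_left _ _) (Real.rpow_nonneg (by positivity) _)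

/-- **No exponent `≤ 1/n` works for `T_s`, `s ≥ 1 + 1/n` (`n ≥ 2`)**: in particular the exponent
`s - 1` of the crux cannot be lowered to (or below) `1/n` at any `s ≥ 1 + 1/n`, and AT `s = 1 + 1/n`
not even `ε = 0` is admissible. [folklore] -/
theorem not_lawAt_of_exponent_le_inv {n : ℕ} (hn : 2 ≤ n) {s e : ℝ} (hs : 1 + 1 / (n : ℝ) ≤ s)
    (he : s - 1 + e ≤ 1 / n) : ¬ LawAt s e := by
  intro h
  have h1 : LawAt (1 + 1 / n) (e + (s - (1 + 1 / n))) := lawAt_of_le hs h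
  have h2 : LawAt (1 + 1 / n) 0 := lawAt_mono h1 (by linarith)
  exact not_lawAt_one_add_inv_zero hn h2

/-! ## §2 Tightness: the exponent `s - 1` is attained at `s = 1 + 1/n` -/

/-- The power family: `(1, r^n - 1, r^n)` has `rad ≤ (r^n - 1) · r < c^{1+1/n}`. [folklore] -/
theorem pow_family_mem {n r N : ℕ} (hn : 1 ≤ n) (hr : 2 ≤ r) (hN : r ^ n ≤ N) :
    ((1, r ^ n - 1, r ^ n) : ℕ × ℕ × ℕ) ∈ mkSet (1 + 1 / n) N := by
  have hrn : 2 ≤ r ^ n :=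
    calc 2 ≤ r := hr
      _ = r ^ 1 := (pow_one r).symm
      _ ≤ r ^ n := Nat.pow_le_pow_right (by omega) hn
  refine ⟨⟨one_pos, ?_, ?_, Nat.coprime_one_left _⟩, hN, ?_⟩
  · show 0 < r ^ n - 1
    omega
  · show 1 + (r ^ n - 1) = r ^ n
    omega
  show ((rad 1 (r ^ n - 1) (r ^ n) : ℕ) : ℝ) ≤ ((r ^ n : ℕ) : ℝ) ^ (1 + 1 / n : ℝ)
  have hr0 : (0 : ℝ) ≤ r := by positivity
  have hpow : ((r ^ n : ℕ) : ℝ) ^ (1 + 1 / n : ℝ) = ((r ^ (n + 1) : ℕ) : ℝ) := by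
    rw [Nat.cast_pow, ← Real.rpow_natCast_mul hr0, Nat.cast_pow]
    have hn0 : (n : ℝ) ≠ 0 := by exact_mod_cast (show n ≠ 0 by omega)
    have : (n : ℝ) * (1 + 1 / n) = ((n + 1 : ℕ) : ℝ) := by push_cast; field_simp
    rw [this, Real.rpow_natCast]
  rw [hpow]
  have hnat : rad 1 (r ^ n - 1) (r ^ n) ≤ r ^ (n + 1) :=
    calc rad 1 (r ^ n - 1) (r ^ n) = radical (1 * (r ^ n - 1) * r ^ n) := rfl
      _ ≤ radical 1 * radical (r ^ n - 1) * radical (r ^ n) := radical_mul_three_le _ _ _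
      _ = radical (r ^ n - 1) * radical r := by
          rw [radical_one, one_mul, radical_pow r (show n ≠ 0 by omega)]
      _ ≤ (r ^ n - 1) * r :=
          Nat.mul_le_mul (Nat.radical_le_self_iff.mpr (by omega))
            (Nat.radical_le_self_iff.mpr (by omega))
      _ ≤ r ^ n * r := Nat.mul_le_mul_right _ (Nat.sub_le _ _)
      _ = r ^ (n + 1) := (pow_succ r n).symm
  exact_mod_cast hnat

/-- **Tightness at `s = 1 + 1/n`**: `T_{1+1/n}(R^n) ≥ R - 1` (the triples `(1, r^n - 1, r^n)`,
`2 ≤ r ≤ R`), i.e. `T_s(N) ≥ N^{s-1} - 1` along `N = R^n`: the exponent `s - 1` of the crux cannot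
be lowered at these `s` (and, by monotonicity of `T_s` in `s`, `T_s(N) ≫ N^{1/n}` for all
`s ≥ 1 + 1/n`). Kane 2011 Thm 1 is the 3-radical refinement. [folklore] -/
theorem tight_at_one_add_inv {n : ℕ} (hn : 1 ≤ n) (R : ℕ) :
    R - 1 ≤ mkCount (1 + 1 / n) (R ^ n) := by
  have hinj : Set.InjOn (fun r : ℕ => ((1, r ^ n - 1, r ^ n) : ℕ × ℕ × ℕ))
      ((Finset.Icc 2 R : Finset ℕ) : Set ℕ) := by
    intro r _ r' _ h
    simp only [Prod.mk.injEq] at h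
    exact Nat.pow_left_injective (by omega : n ≠ 0) h.2.2
  calc R - 1 = (Finset.Icc 2 R).card := by simp
    _ = ((Finset.Icc 2 R).image fun r : ℕ => ((1, r ^ n - 1, r ^ n) : ℕ × ℕ × ℕ)).card :=
        (Finset.card_image_of_injOn hinj).symm
    _ = (((Finset.Icc 2 R).image fun r : ℕ => ((1, r ^ n - 1, r ^ n) : ℕ × ℕ × ℕ) :
          Finset _) : Set (ℕ × ℕ × ℕ)).ncard := (Set.ncard_coe_finset _).symm
    _ ≤ mkCount (1 + 1 / n) (R ^ n) := by
        refine Set.ncard_le_ncard ?_ (mkSet_finite _ _)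
        intro t ht
        rw [Finset.mem_coe, Finset.mem_image] at ht
        obtain ⟨r, hr, rfl⟩ := ht
        rw [Finset.mem_Icc] at hr
        exact pow_family_mem hn hr.1 (Nat.pow_le_pow_left hr.2 n)

/-! ## §3 Strength gauge: the crux near `s → 1⁺` is "abc hits are `X^{o(1)}`" -/

/-- **The crux implies `N(X) ≪_δ X^δ` for the number of abc hits, for every `δ > 0`.**
(Take `s = 1 + δ/2`, `ε = δ/2`; hits have `rad < c ≤ c^s`.) The record is `X^{0.65}`
(Bernert–Browning–Lichtman–Teräväinen 2026, tree fact `bernertEtAl2024_thm_1_2`), the trivial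
bound `X^{2/3+ε}` is proved in the tree (`ABCHitCountUpperBound_holds`); so the crux is far
beyond the state of the art already at the endpoint, though consistent with Dahmen's lower
bound `exp((log X)^{1/2-ε})`. [folklore] -/
theorem abcHitCount_le_of_mazurKaneLaw (h : MazurKaneLaw) (δ : ℝ) (hδ : 0 < δ) :
    ∃ C : ℝ, ∀ N : ℕ, 2 ≤ N → (abcHitCount N : ℝ) ≤ C * (N : ℝ) ^ δ := by
  rw [mazurKaneLaw_iff] at h
  set δ' : ℝ := min δ 1 with hδ'
  have hδ'0 : 0 < δ' := lt_min hδ one_pos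
  have hδ'1 : δ' ≤ 1 := min_le_right _ _
  have hδ'δ : δ' ≤ δ := min_le_left _ _
  obtain ⟨C, hC⟩ := h (1 + δ' / 2) (by linarith) (by linarith) (δ' / 2) (by linarith)
  refine ⟨max C 0, fun N hN => ?_⟩
  have hN1 : (1 : ℝ) ≤ N := by exact_mod_cast (show 1 ≤ N by omega)
  calc (abcHitCount N : ℝ) = abcExponentCount 1 N := by rw [abcExponentCount_one]
    _ ≤ mkCount (1 + δ' / 2) N := by
        exact_mod_cast (abcExponentCount_mono_left (by linarith) N).trans
          (abcExponentCount_le_mkCount _ N)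
    _ ≤ C * (N : ℝ) ^ (1 + δ' / 2 - 1 + δ' / 2) := hC N hN
    _ ≤ max C 0 * (N : ℝ) ^ (1 + δ' / 2 - 1 + δ' / 2) :=
        mul_le_mul_of_nonneg_right (le_max_left _ _) (Real.rpow_nonneg (by positivity) _)
    _ ≤ max C 0 * (N : ℝ) ^ δ :=
        mul_le_mul_of_nonneg_left (Real.rpow_le_rpow_of_exponent_le hN1 (by linarith))
          (le_max_right _ _)


/-! ## §4 Why the crux resists (running commentary for provers; no Lean content)

ATTACKS TRIED (cycle 1, 2026-08-15) — none touches the ε-form of the crux: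

1. *Explicit algebraic families.* A one-parameter polynomial identity `a(t) + b(t) = c(t)`,
   `deg c = n`, has `deg rad(abc) = n₀ ≥ n + 1` (Mason–Stothers), so it produces `≍ N^{1/n}`
   triples of exponent `s = n₀/n ≥ 1 + 1/n`, i.e. AT MOST `N^{s-1}`: on the law, with equality iff
   the identity is Belyi-extremal (`n₀ = n + 1`: `(1, rⁿ-1, rⁿ)`, Pell/Chebyshev families
   `(1, D y_k², x_k²)`, `(x², 2x+1, (x+1)²)`, …). Binary forms of degree `n` (two parameters) have
   `n₀ ≥ n + 2` projective linear factors, count `N^{2/n} ≤ N^{s-1}` again. Restricting parameters to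
   smooth/powerful values re-derives the same exponent (the heuristic `#{m ≤ x : rad m ≤ x^θ} =
   x^{θ+o(1)}` is self-consistent under substitution). Discrete extra parameters (powers of 2, 3 in
   `r`) add only logarithms — this is exactly what §1 exploits, and it is all they give.
2. *Small `a`.* `a ≤ A` fixed: `(a, c-a, c)` needs `bc/rad(bc) ≳ a c^{2-s}`; density `≍ c^{s-2}/a`
   up to logs; summing over `c ≤ N`, `a ≤ A`: `N^{s-1} log A`. On the law.
3. *CENSUS* (kit job j013937, `c ≤ 2·10⁵`, all ordered coprime `a + b = c`, exact radicals;
   validated: `(T_1(10³)-1)/2 = 31`, `(T_1(10⁵)-1)/2 = 419` = the known abc-hit counts; j013938 to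
   `10⁶` pending). `T_s(N)` and the decade slope `log₁₀(T_s(10⁵)/T_s(10⁴))` against the law's `s-1`:
   ```
   s     T(1e4)    T(1e5)    T(2e5)  slope  s-1   T(2e5)/(2e5)^(s-1)
   1.00     243       839      1213  0.538  0.00   1213
   1.10     603      2483      3793  0.615  0.10   1119
   1.25    2263     12719     21223  0.750  0.25   1004
   1.50   18603    167399    323459  0.954  0.50    723
   1.75  121887   1785157   3961381  1.166  0.75    419
   1.95  466221  10054757  24958261  1.334  0.95    230
   ```
   The empirical exponent exceeds `s - 1` by `0.38–0.54` UNIFORMLY in `s` at these heights and the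
   would-be constant `T/N^{s-1}` is `230–1213` and still rising: below `10⁶` the data cannot
   distinguish `N^{s-1+o(1)}` from `N^{s-1+0.4}` — the `N^{o(1)}` factor (cf. hits: local slope `0.45`
   at `10⁵`, `0.31` at `10¹⁸` in the ABC@home counts) decays far too slowly for numerics to guide a
   prover; share of counted triples with `c` a perfect power: `51%` (s=1) → `10%` (s=1.95); with
   `min(a,b) = 1`: `13%` → `1%`.
4. *Near `s → 1⁺`.* The crux implies abc hits are `X^{o(1)}` (§3). Known: Dahmen 2008 lower bound
   `exp((log X)^{1/2-ε})` (tree, proved), de Bruijn/Robert–Stewart–Tenenbaum heuristics predict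
   `exp((log X)^{1/2+o(1)})`-type growth, ABC@home data (14.5·10⁶ hits below 10¹⁸ ≈ X^{0.40}, local
   slope falling from 0.45 to 0.31 per the published decade counts) are consistent with `X^{o(1)}`
   but show the `o(1)` is numerically large — a prover should expect NO clean power saving to be
   visible in data below 10¹⁸ for `s < 1.3`. (Census job: see NOTES / item evidence `mk-census-1e6`.)
5. *Upper-bound technology* (where a proof would have to come from): Kane 2011 Thm 2
   `O(N^{a+b+c-1+ε} + N^{1+ε})` (lattices + Heath-Brown conic count) — the parasitic `N^{1+ε}` is
   exactly the obstruction for `s < 2` (Kane p. 6: "our upper bounds likely cannot be extended much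
   either"); BLT 2024/Bernert 2025/BBLT 2026 Thm 1.2: `N_λ(X) ≪ X^{(23λ+3)/40+ε}` on `(0,2]`, which
   beats the trivial `2λ/3` only near `λ ≤ 1.28` and is `> λ - 1` on all of `(1,2)` (equality would
   need `λ = 43/17`). So the crux asks for a power saving of `(23λ+3)/40 - (λ-1) = (43-17λ)/40 ≥ 9/40`
   over the 2026 record, uniformly on `(1,2)`.
6. *Mis-statement checks* (none found): set finite (`a,b < c ≤ N`), `rad` computed in `ℕ`, `C` may
   depend on `(s, ε)`, ordered triples (factor 2), `≤` vs `<` immaterial (§0), `N ≥ 2` immaterial,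
   box-normalisation `rad ≤ N^s` (instead of `c^s`) would be trivially false for `s < 3` (all
   `c ≤ N^{s/3}` count) — the planner's `c^s` is the right normalisation.

OPEN ENDS for cycle 2: (i) census to `10⁶` (j013938 running; `2·10⁵` folded in item 3); (ii) [DONE: Mazur, Notices 47 (2000) p. 198 read — "card S(a;b;c;X) ≍ X^d?", at
once split by Mazur into `X^{d+ε}` upper / `X^{d-ε}` lower tasks; p. 199: Wooley's circle-method
answer for `a,b,c ≤ 6/5`, i.e. Kane's "5/6 ≤ a,b,c ≤ 1"]; (iii) [DONE this cycle:
`abcExponentCount_not_bigO`] the sharp law fails at EVERY `s ∈ (1,2)`; with `P` primes in `r` instead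
of `{2,3}` the same family gives `T_s(N) ≫ N^{s-1} (log N)^{P-1}`, so the `N^{o(1)}` factor is
unbounded by any fixed power of `log` — not formalised (no new message).
-/

end Summit.ABC.ABC.Cruxes.MazurKaneLaw.Disproof
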